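import Literature.MathematicalPhysics.QuantumLattice.DWaveOrderParameterUCells
import HarnessLib

/-!
# `d`-wave order-parameter and pair-amplitude CEILINGS on a `(t', U)` RECTANGLE from its FOUR CORNERS: two-step
# chord floors (zero loss), caps = lower envelope of the four corner TANGENT PLANES (`K₂`-words × docc-words),
# and a uniform NESTED-BULGE bound second order in both widths

Topic `Literature/MathematicalPhysics/QuantumLattice` (namespace = path; family `hubbard`). The composition of
`DWaveOrderParameterTPrimeCells.lean` (hubbard-box-p3: two-anchor `t'`-intervals, diagonal-hopping `K₂`-word tangents)
and `DWaveOrderParameterUCells.lean` (hubbard-downfold-unc-1: two-anchor `U`-intervals, double-occupancy-word tangents)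
on the product cell `[s₁,s₂] × [U₁,U₂]`: the fast cell's §5 / the `U`-file's §5 serve the second direction only by
monotonicity; here BOTH directions are second order, from CORNER data only — per corner `(sⱼ, Uᵢ)`: a source-free
cap (`hiⱼᵢ ≥ E(sⱼ,Uᵢ,μ,0)`, or a canonical cap `Rⱼᵢ ≥ e(1,sⱼ,Uᵢ,n)`), a sourced floor `loⱼᵢ ≤ E(sⱼ,Uᵢ,μ,h)`, and ONE
END of each slope bracket, dictated by the corner's position: `K₂` CEILINGS `K₁ᵢ` on the LEFT column, `K₂` FLOORS
`J₂ᵢ` on the RIGHT column, docc CEILINGS `Aⱼ₁` on the LOWER row, docc FLOORS `Bⱼ₂` on the UPPER row (grand-canonical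
minimiser words, or the registry's canonical torus-limit rows — `K₂` rows as in `HubbardTTPrimeTwoColumnCaps`, docc rows
as #257/#261).

* §1 JOINT TANGENT PLANE at a translation-invariant sourced ground state:
  `E(s',U',μ,h) ≤ E(s,U,μ,h) + (s' − s)·K₂(ω) + (U' − U)·D(ω)`; canonical corner plane with one-sided words
  (`energyDensityTT'_le_cornerPlane_of_forall_isTorusLimitOf_words`).
* §2 TWO-STEP CHORD FLOOR (zero loss): `t'`-chords `Λᵢ(s)` along the two rows, then the `U`-chord of
  `Λ₁(s), Λ₂(s)` — bilinear interpolation of the four corner floors.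
* §3 POINTWISE CAP = min of the four corner planes
  `P₁₁ = hi₁₁ + K₁₁(s − s₁) + A₁₁(U − U₁)`, `P₁₂ = hi₁₂ + K₁₂(s − s₁) − B₁₂(U₂ − U)`,
  `P₂₁ = hi₂₁ − J₂₁(s₂ − s) + A₂₁(U − U₁)`, `P₂₂ = hi₂₂ − J₂₂(s₂ − s) − B₂₂(U₂ − U)` (grand-canonical words; canonical
  words with `Rⱼᵢ` and Legendre `− μn`).
* §4 POINTWISE ORDER CEILING `m⋆(s,U,μ) ≤ (min Pⱼᵢ − bilinear floor)/(2h)` on the rectangle (both editions), and the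
  near-minimiser pair-amplitude currency on the `(t', U) × [μ₁,μ₂]` cell of object M (`t''` on).
* §5 THE UNIFORM NESTED BULGE: for every `(s,U)` in the rectangle the §4 numerator is at most
  `max(G₁ + w_U·H(A₁₁ − σ⁻, σ⁺ − B₁₂), G₂ + w_U·H(A₂₁ − σ⁻, σ⁺ − B₂₂)) + w_s·H(a₁, b₂)`,
  `H(a,b) = a⁺b⁺/(a⁺ + b⁺)`, `Gⱼ = max(gⱼ₁, gⱼ₂)` the column's anchor gaps, `σ∓` = min / max of the two columns'
  sourced `U`-secant slopes `(loⱼ₂ − loⱼ₁)/w_U`, `a₁ = maxᵢ(K₁ᵢ − σ_{s,i})`, `b₂ = maxᵢ(σ_{s,i} − J₂ᵢ)`,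
  `σ_{s,i} = (lo₂ᵢ − lo₁ᵢ)/w_s` (a `U`-bulge per column, then a `t'`-bulge across — twice the one-dimensional lemma
  `min_tangents_sub_chord_le_bulge` plus monotonicity of `H`); ABSENT(`< m₀`) on the whole rectangle / cell.

HONEST SCOPE: ceiling-side bookkeeping; nothing here floors `d`-wave order; every output is conditional on the
corner certificates fed in (per rectangle: four object-E pairs, four one-sided `K₂` words, four one-sided docc
words). Everything is PROVED; no definition, no named fact, zero compute, no `sorry`.

## References
* R. B. Griffiths, J. Math. Phys. 5 (1964) 1215, §II (chord bounds for concave thermodynamic functions).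
  [cite: Griffiths1964, §II]
* R. B. Israel, *Convexity in the Theory of Lattice Gases* (1979), Thm. I.3.4 (tangent functionals at a minimiser;
  joint concavity in the interaction). [cite: Israel1979, Thm. I.3.4]
* T. Koma, H. Tasaki, J. Stat. Phys. 76 (1994) 745–803, §1 (the quasi-average order parameter and its secant bound).
  [cite: KomaTasaki1994, §1]
* D. Ruelle, *Statistical Mechanics: Rigorous Results* (1969), §3.4 (Legendre duality). [cite: Ruelle1969, §3.4]
* A. Neumaier, *Complete search in continuous global optimization*, Acta Numerica 13 (2004), §11 (lower envelopes
  of affine majorants). [cite: Neumaier2004CompleteSearch, §11]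
-/

noncomputable section

namespace Literature.MathematicalPhysics.QuantumLattice

open _root_.Matrix Finset Set HubbardWave0 Literature.Probability.LatticeModels ThermodynamicLimit _root_.Filter
open scoped _root_.Topology

/-! ### §1 Joint tangent planes at a corner -/

section Planes

/-- **Joint tangent plane at a translation-invariant sourced ground state** (minimiser form): if `ω` minimises the
mean energy of the sourced interaction at `(s,U,μ,h)` then for all real `s', U'`,
`E(s',U',μ,h) ≤ E(s,U,μ,h) + (s' − s)·K₂(ω) + (U' − U)·D(ω)` (the mean energy is affine in `(s,U)`).
[cite: Israel1979, Thm. I.3.4] -/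
theorem InfVolFermionState.IsMeanEnergyMinimiser.dWaveSourceEnergyDensityTT'_le_plane {s U μ h : ℝ}
    {ω : InfVolFermionState 2}
    (hω : ω.IsMeanEnergyMinimiser (hubbardTTPrimeSourcedInteraction 1 s U μ dWaveFormFactor h) 1) (s' U' : ℝ) :
    dWaveSourceEnergyDensityTT' s' U' μ h ≤
      dWaveSourceEnergyDensityTT' s U μ h + (s' - s) * ω.meanEnergy (hubbardTTPrimeFermionInteraction 0 1 0) 1 +
        (U' - U) * ω.meanEnergy (hubbardTTPrimeFermionInteraction 0 0 1) 1 := by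
  have hωe : (ω.expect dWaveSourceWindow (dWaveSourceEnergyObsTT' s U μ h)).re = dWaveSourceEnergyDensityTT' s U μ h := by
    rw [ω.re_expect_dWaveSourceEnergyObsTT' s U μ h, hω.meanEnergy_eq,
      dWaveSourceEnergyDensityTT'_eq_tiGroundEnergyDensity]
  have hvar := dWaveSourceEnergyDensityTT'_le_re_expect s' U' μ h ω hω.1
  rw [ω.re_expect_dWaveSourceEnergyObsTT' s' U' μ h, InfVolFermionState.meanEnergy_hubbardTTPrimeSourced,
    ω.meanEnergy_hubbardTTPrime_affine 1 s U s' U'] at hvar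
  rw [ω.re_expect_dWaveSourceEnergyObsTT' s U μ h, InfVolFermionState.meanEnergy_hubbardTTPrimeSourced] at hωe
  linarith

/-- **Canonical corner plane with ONE-SIDED slope words** (signed form): an anchor cap `e(t,s₀,U₀,n) ≤ R`
(`U₀, U ≥ 0`, `0 ≤ n < 2`) and, for every torus limit of unit sector ground states at the anchor, the signed word
`(U − U₀)·Re ω(n_{0↑}n_{0↓}) + (s − s₀)·K₂(ω) ≤ (U − U₀)·d + (s − s₀)·τ` give
`e(t,s,U,n) ≤ R + (U − U₀)·d + (s − s₀)·τ` (the joint supergradient at an existing torus-limit ground state).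
[cite: KomaTasaki1994, §1] -/
theorem energyDensityTT'_le_cornerPlane_of_forall_isTorusLimitOf_words (t s₀ s : ℝ) {U₀ U : ℝ} (hU₀ : 0 ≤ U₀)
    (hU : 0 ≤ U) {n : ℝ} (hn0 : 0 ≤ n) (hn2 : n < 2) {R d τ : ℝ} (hR : energyDensityTT' t s₀ U₀ n ≤ R)
    (hw : ∀ (ω : InfVolFermionState 2) (Ls : ℕ → ℕ) (ψ : ∀ L, Fock (Orb (FermionTorus 2 L))),
      Tendsto Ls atTop atTop →
      (∀ j, IsGroundStateInSector (hubbardTorusTT' (Ls j) t s₀ U₀) (rectN n (Ls j)) 0 (ψ (Ls j))) →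
      (∀ j, star (ψ (Ls j)) ⬝ᵥ ψ (Ls j) = 1) → ω.IsTorusLimitOf ψ Ls →
      (U - U₀) * (ω.expect ({0} : Finset (Site 2))
          (nAt 0 (Finset.mem_singleton_self 0) 0 * nAt 0 (Finset.mem_singleton_self 0) 1)).re +
        (s - s₀) * ω.meanEnergy (hubbardTTPrimeFermionInteraction 0 1 0) 1 ≤ (U - U₀) * d + (s - s₀) * τ) :
    energyDensityTT' t s U n ≤ R + (U - U₀) * d + (s - s₀) * τ := by
  obtain ⟨ψ, Ls, ω, hLs, hω, -, -, h1, hψ, -, -, -⟩ :=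
    exists_isTorusLimitOf_squareGroundStatesTT'_meanEnergy_eq t s₀ hU₀ hn0 hn2
  have ha := hw ω Ls ψ hLs hψ h1 hω
  have hb := hω.energyDensityTT'_le_affine_docc t s₀ hU₀ hn0 hn2 hLs hψ h1 s hU
  linarith

end Planes

/-! ### §2 The two-step chord floor on a rectangle (zero loss) -/

section Floor

/-- **BILINEAR FLOOR from the four corner floors**: for `s₁ < s₂`, `U₁ < U₂`, `(s,U)` in the rectangle, floors
`loⱼᵢ ≤ E(sⱼ,Uᵢ,μ,h)` give `Λ₁(s) + (Λ₂(s) − Λ₁(s))(U − U₁)/(U₂ − U₁) ≤ E(s,U,μ,h)` with the row chords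
`Λᵢ(s) = lo₁ᵢ + (lo₂ᵢ − lo₁ᵢ)(s − s₁)/(s₂ − s₁)` (`t'`-chords along the two rows, then the `U`-chord: joint
concavity, no loss). [cite: Griffiths1964, §II] -/
theorem dWaveSourceEnergyDensityTT'_rect_ge_bilinear {s₁ s₂ U₁ U₂ s U μ h lo₁₁ lo₂₁ lo₁₂ lo₂₂ : ℝ}
    (hs : s₁ < s₂) (hUlt : U₁ < U₂) (hs₁ : s₁ ≤ s) (hs₂ : s ≤ s₂) (hU₁ : U₁ ≤ U) (hU₂ : U ≤ U₂)
    (hlo₁₁ : lo₁₁ ≤ dWaveSourceEnergyDensityTT' s₁ U₁ μ h) (hlo₂₁ : lo₂₁ ≤ dWaveSourceEnergyDensityTT' s₂ U₁ μ h)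
    (hlo₁₂ : lo₁₂ ≤ dWaveSourceEnergyDensityTT' s₁ U₂ μ h) (hlo₂₂ : lo₂₂ ≤ dWaveSourceEnergyDensityTT' s₂ U₂ μ h) :
    (lo₁₁ + (lo₂₁ - lo₁₁) * (s - s₁) / (s₂ - s₁)) +
        ((lo₁₂ + (lo₂₂ - lo₁₂) * (s - s₁) / (s₂ - s₁)) - (lo₁₁ + (lo₂₁ - lo₁₁) * (s - s₁) / (s₂ - s₁))) *
          (U - U₁) / (U₂ - U₁) ≤
      dWaveSourceEnergyDensityTT' s U μ h :=
  dWaveSourceEnergyDensityTT'_ge_U_chord hUlt hU₁ hU₂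
    (dWaveSourceEnergyDensityTT'_ge_tPrime_chord hs hs₁ hs₂ hlo₁₁ hlo₂₁)
    (dWaveSourceEnergyDensityTT'_ge_tPrime_chord hs hs₁ hs₂ hlo₁₂ hlo₂₂)

/-- An affine interpolation between `lo₁` (at `U₁`) and `lo₂` (at `U₂`) is at least `min lo₁ lo₂` on `[U₁,U₂]`.
[folklore] -/
private theorem min_le_affine_interp {lo₁ lo₂ U₁ U₂ U : ℝ} (hUlt : U₁ < U₂) (hU₁ : U₁ ≤ U) (hU₂ : U ≤ U₂) :
    min lo₁ lo₂ ≤ lo₁ + (lo₂ - lo₁) * (U - U₁) / (U₂ - U₁) := by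
  have hd : 0 < U₂ - U₁ := sub_pos.2 hUlt
  set θ := (U - U₁) / (U₂ - U₁) with hθ
  have hθ0 : 0 ≤ θ := div_nonneg (sub_nonneg.2 hU₁) hd.le
  have hθ1 : θ ≤ 1 := by rw [hθ, div_le_one hd]; linarith
  have e : lo₁ + (lo₂ - lo₁) * (U - U₁) / (U₂ - U₁) = (1 - θ) * lo₁ + θ * lo₂ := by
    rw [hθ]
    ring
  rw [e]
  have a := mul_le_mul_of_nonneg_left (min_le_left lo₁ lo₂) (sub_nonneg.2 hθ1)
  have b := mul_le_mul_of_nonneg_left (min_le_right lo₁ lo₂) hθ0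
  linarith

/-- **Uniform floor**: the bilinear floor is at least the smallest corner floor, so
`min(min lo₁₁ lo₂₁, min lo₁₂ lo₂₂) ≤ E(s,U,μ,h)` on the rectangle. [cite: Griffiths1964, §II] -/
theorem dWaveSourceEnergyDensityTT'_rect_ge_min_corners {s₁ s₂ U₁ U₂ s U μ h lo₁₁ lo₂₁ lo₁₂ lo₂₂ : ℝ}
    (hs₁ : s₁ ≤ s) (hs₂ : s ≤ s₂) (hU₁ : U₁ ≤ U) (hU₂ : U ≤ U₂)
    (hlo₁₁ : lo₁₁ ≤ dWaveSourceEnergyDensityTT' s₁ U₁ μ h) (hlo₂₁ : lo₂₁ ≤ dWaveSourceEnergyDensityTT' s₂ U₁ μ h)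
    (hlo₁₂ : lo₁₂ ≤ dWaveSourceEnergyDensityTT' s₁ U₂ μ h) (hlo₂₂ : lo₂₂ ≤ dWaveSourceEnergyDensityTT' s₂ U₂ μ h) :
    min (min lo₁₁ lo₂₁) (min lo₁₂ lo₂₂) ≤ dWaveSourceEnergyDensityTT' s U μ h := by
  have r₁ := dWaveSourceEnergyDensityTT'_tPrime_interval_ge hs₁ hs₂ hlo₁₁ hlo₂₁
  have r₂ := dWaveSourceEnergyDensityTT'_tPrime_interval_ge hs₁ hs₂ hlo₁₂ hlo₂₂
  rcases eq_or_lt_of_le (hU₁.trans hU₂) with hUeq | hUlt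
  · have hUU : U = U₁ := le_antisymm (hUeq ▸ hU₂) hU₁
    rw [hUU]
    exact (min_le_left _ _).trans r₁
  · exact (min_le_affine_interp hUlt hU₁ hU₂).trans (dWaveSourceEnergyDensityTT'_ge_U_chord hUlt hU₁ hU₂ r₁ r₂)

end Floor

/-! ### §3 Pointwise cap on a rectangle: the lower envelope of the four corner planes -/

section CapGC

/-- **FOUR CORNER PLANES (grand-canonical words).** On `[s₁,s₂] × [U₁,U₂]` let caps `E(sⱼ,Uᵢ,μ,h) ≤ hiⱼᵢ` be given
at the four corners together with one-sided slope words on the translation-invariant sourced ground states there: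
`K₂ ≤ K₁₁` and `D ≤ A₁₁` at `(s₁,U₁)`; `K₂ ≤ K₁₂` and `D ≥ B₁₂` at `(s₁,U₂)`; `K₂ ≥ J₂₁` and `D ≤ A₂₁` at `(s₂,U₁)`;
`K₂ ≥ J₂₂` and `D ≥ B₂₂` at `(s₂,U₂)`. Then at every `(s,U)` in the rectangle
`E(s,U,μ,h) ≤ min(min P₁₁ P₁₂, min P₂₁ P₂₂)` with `P₁₁ = hi₁₁ + K₁₁(s − s₁) + A₁₁(U − U₁)`,
`P₁₂ = hi₁₂ + K₁₂(s − s₁) − B₁₂(U₂ − U)`, `P₂₁ = hi₂₁ − J₂₁(s₂ − s) + A₂₁(U − U₁)`, `P₂₂ = hi₂₂ − J₂₂(s₂ − s) − B₂₂(U₂ − U)`.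
[cite: Israel1979, Thm. I.3.4] -/
theorem dWaveSourceEnergyDensityTT'_rect_le_cornerPlanes_of_words
    {s₁ s₂ U₁ U₂ s U μ h hi₁₁ hi₂₁ hi₁₂ hi₂₂ K₁₁ K₁₂ J₂₁ J₂₂ A₁₁ A₂₁ B₁₂ B₂₂ : ℝ}
    (hs₁ : s₁ ≤ s) (hs₂ : s ≤ s₂) (hU₁ : U₁ ≤ U) (hU₂ : U ≤ U₂)
    (hhi₁₁ : dWaveSourceEnergyDensityTT' s₁ U₁ μ h ≤ hi₁₁) (hhi₂₁ : dWaveSourceEnergyDensityTT' s₂ U₁ μ h ≤ hi₂₁)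
    (hhi₁₂ : dWaveSourceEnergyDensityTT' s₁ U₂ μ h ≤ hi₁₂) (hhi₂₂ : dWaveSourceEnergyDensityTT' s₂ U₂ μ h ≤ hi₂₂)
    (h₁₁ : ∀ ω : InfVolFermionState 2,
      ω.IsMeanEnergyMinimiser (hubbardTTPrimeSourcedInteraction 1 s₁ U₁ μ dWaveFormFactor h) 1 →
        ω.meanEnergy (hubbardTTPrimeFermionInteraction 0 1 0) 1 ≤ K₁₁ ∧
          ω.meanEnergy (hubbardTTPrimeFermionInteraction 0 0 1) 1 ≤ A₁₁)
    (h₁₂ : ∀ ω : InfVolFermionState 2,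
      ω.IsMeanEnergyMinimiser (hubbardTTPrimeSourcedInteraction 1 s₁ U₂ μ dWaveFormFactor h) 1 →
        ω.meanEnergy (hubbardTTPrimeFermionInteraction 0 1 0) 1 ≤ K₁₂ ∧
          B₁₂ ≤ ω.meanEnergy (hubbardTTPrimeFermionInteraction 0 0 1) 1)
    (h₂₁ : ∀ ω : InfVolFermionState 2,
      ω.IsMeanEnergyMinimiser (hubbardTTPrimeSourcedInteraction 1 s₂ U₁ μ dWaveFormFactor h) 1 →
        J₂₁ ≤ ω.meanEnergy (hubbardTTPrimeFermionInteraction 0 1 0) 1 ∧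
          ω.meanEnergy (hubbardTTPrimeFermionInteraction 0 0 1) 1 ≤ A₂₁)
    (h₂₂ : ∀ ω : InfVolFermionState 2,
      ω.IsMeanEnergyMinimiser (hubbardTTPrimeSourcedInteraction 1 s₂ U₂ μ dWaveFormFactor h) 1 →
        J₂₂ ≤ ω.meanEnergy (hubbardTTPrimeFermionInteraction 0 1 0) 1 ∧
          B₂₂ ≤ ω.meanEnergy (hubbardTTPrimeFermionInteraction 0 0 1) 1) :
    dWaveSourceEnergyDensityTT' s U μ h ≤
      min (min (hi₁₁ + K₁₁ * (s - s₁) + A₁₁ * (U - U₁)) (hi₁₂ + K₁₂ * (s - s₁) - B₁₂ * (U₂ - U)))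
        (min (hi₂₁ - J₂₁ * (s₂ - s) + A₂₁ * (U - U₁)) (hi₂₂ - J₂₂ * (s₂ - s) - B₂₂ * (U₂ - U))) := by
  obtain ⟨ω₁₁, hω₁₁⟩ := (hubbardTTPrimeSourcedInteraction 1 s₁ U₁ μ dWaveFormFactor h).exists_isMeanEnergyMinimiser 1
  obtain ⟨ω₁₂, hω₁₂⟩ := (hubbardTTPrimeSourcedInteraction 1 s₁ U₂ μ dWaveFormFactor h).exists_isMeanEnergyMinimiser 1
  obtain ⟨ω₂₁, hω₂₁⟩ := (hubbardTTPrimeSourcedInteraction 1 s₂ U₁ μ dWaveFormFactor h).exists_isMeanEnergyMinimiser 1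
  obtain ⟨ω₂₂, hω₂₂⟩ := (hubbardTTPrimeSourcedInteraction 1 s₂ U₂ μ dWaveFormFactor h).exists_isMeanEnergyMinimiser 1
  have t₁₁ := hω₁₁.dWaveSourceEnergyDensityTT'_le_plane s U
  have t₁₂ := hω₁₂.dWaveSourceEnergyDensityTT'_le_plane s U
  have t₂₁ := hω₂₁.dWaveSourceEnergyDensityTT'_le_plane s U
  have t₂₂ := hω₂₂.dWaveSourceEnergyDensityTT'_le_plane s U
  obtain ⟨k₁₁, a₁₁⟩ := h₁₁ ω₁₁ hω₁₁
  obtain ⟨k₁₂, b₁₂⟩ := h₁₂ ω₁₂ hω₁₂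
  obtain ⟨j₂₁, a₂₁⟩ := h₂₁ ω₂₁ hω₂₁
  obtain ⟨j₂₂, b₂₂⟩ := h₂₂ ω₂₂ hω₂₂
  have hss₁ : 0 ≤ s - s₁ := sub_nonneg.2 hs₁
  have hss₂ : 0 ≤ s₂ - s := sub_nonneg.2 hs₂
  have hUU₁ : 0 ≤ U - U₁ := sub_nonneg.2 hU₁
  have hUU₂ : 0 ≤ U₂ - U := sub_nonneg.2 hU₂
  refine le_min (le_min ?_ ?_) (le_min ?_ ?_)
  · nlinarith [mul_le_mul_of_nonneg_left k₁₁ hss₁, mul_le_mul_of_nonneg_left a₁₁ hUU₁]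
  · nlinarith [mul_le_mul_of_nonneg_left k₁₂ hss₁, mul_le_mul_of_nonneg_left b₁₂ hUU₂]
  · nlinarith [mul_le_mul_of_nonneg_left j₂₁ hss₂, mul_le_mul_of_nonneg_left a₂₁ hUU₁]
  · nlinarith [mul_le_mul_of_nonneg_left j₂₂ hss₂, mul_le_mul_of_nonneg_left b₂₂ hUU₂]

end CapGC

section CapCanonical

/-- **FOUR CORNER PLANES, CANONICAL words** (the certificate format of record). On `[s₁,s₂] × [U₁,U₂]` (`U₁ ≥ 0`,
`0 ≤ n < 2`) let canonical caps `e(t,sⱼ,Uᵢ,n) ≤ Rⱼᵢ` be given at the four corners together with one-sided rows on the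
torus limits of unit `(rectN n L, S^z = 0)`-sector ground states there — `K₂ ≤ K₁ᵢ` (left column), `J₂ᵢ ≤ K₂` (right
column), `Re ω(n_{0↑}n_{0↓}) ≤ Aⱼ₁` (lower row), `Bⱼ₂ ≤ Re ω(n_{0↑}n_{0↓})` (upper row). Then at every `(s,U)` in the
rectangle `e(t,s,U,n) ≤ min(min P₁₁ P₁₂, min P₂₁ P₂₂)` (planes as in the grand-canonical theorem with `Rⱼᵢ` for
`hiⱼᵢ`). [cite: KomaTasaki1994, §1] -/
theorem energyDensityTT'_rect_le_cornerPlanes_of_words (t : ℝ)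
    {s₁ s₂ U₁ U₂ s U : ℝ} (hU₁0 : 0 ≤ U₁) (hs₁ : s₁ ≤ s) (hs₂ : s ≤ s₂) (hU₁ : U₁ ≤ U) (hU₂ : U ≤ U₂)
    {n : ℝ} (hn0 : 0 ≤ n) (hn2 : n < 2) {R₁₁ R₂₁ R₁₂ R₂₂ K₁₁ K₁₂ J₂₁ J₂₂ A₁₁ A₂₁ B₁₂ B₂₂ : ℝ}
    (hR₁₁ : energyDensityTT' t s₁ U₁ n ≤ R₁₁) (hR₂₁ : energyDensityTT' t s₂ U₁ n ≤ R₂₁)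
    (hR₁₂ : energyDensityTT' t s₁ U₂ n ≤ R₁₂) (hR₂₂ : energyDensityTT' t s₂ U₂ n ≤ R₂₂)
    (h₁₁ : ∀ (ω : InfVolFermionState 2) (Ls : ℕ → ℕ) (ψ : ∀ L, Fock (Orb (FermionTorus 2 L))),
      Tendsto Ls atTop atTop →
      (∀ j, IsGroundStateInSector (hubbardTorusTT' (Ls j) t s₁ U₁) (rectN n (Ls j)) 0 (ψ (Ls j))) →
      (∀ j, star (ψ (Ls j)) ⬝ᵥ ψ (Ls j) = 1) → ω.IsTorusLimitOf ψ Ls →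
      ω.meanEnergy (hubbardTTPrimeFermionInteraction 0 1 0) 1 ≤ K₁₁ ∧
        (ω.expect ({0} : Finset (Site 2))
          (nAt 0 (Finset.mem_singleton_self 0) 0 * nAt 0 (Finset.mem_singleton_self 0) 1)).re ≤ A₁₁)
    (h₁₂ : ∀ (ω : InfVolFermionState 2) (Ls : ℕ → ℕ) (ψ : ∀ L, Fock (Orb (FermionTorus 2 L))),
      Tendsto Ls atTop atTop →
      (∀ j, IsGroundStateInSector (hubbardTorusTT' (Ls j) t s₁ U₂) (rectN n (Ls j)) 0 (ψ (Ls j))) →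
      (∀ j, star (ψ (Ls j)) ⬝ᵥ ψ (Ls j) = 1) → ω.IsTorusLimitOf ψ Ls →
      ω.meanEnergy (hubbardTTPrimeFermionInteraction 0 1 0) 1 ≤ K₁₂ ∧
        B₁₂ ≤ (ω.expect ({0} : Finset (Site 2))
          (nAt 0 (Finset.mem_singleton_self 0) 0 * nAt 0 (Finset.mem_singleton_self 0) 1)).re)
    (h₂₁ : ∀ (ω : InfVolFermionState 2) (Ls : ℕ → ℕ) (ψ : ∀ L, Fock (Orb (FermionTorus 2 L))),
      Tendsto Ls atTop atTop →
      (∀ j, IsGroundStateInSector (hubbardTorusTT' (Ls j) t s₂ U₁) (rectN n (Ls j)) 0 (ψ (Ls j))) →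
      (∀ j, star (ψ (Ls j)) ⬝ᵥ ψ (Ls j) = 1) → ω.IsTorusLimitOf ψ Ls →
      J₂₁ ≤ ω.meanEnergy (hubbardTTPrimeFermionInteraction 0 1 0) 1 ∧
        (ω.expect ({0} : Finset (Site 2))
          (nAt 0 (Finset.mem_singleton_self 0) 0 * nAt 0 (Finset.mem_singleton_self 0) 1)).re ≤ A₂₁)
    (h₂₂ : ∀ (ω : InfVolFermionState 2) (Ls : ℕ → ℕ) (ψ : ∀ L, Fock (Orb (FermionTorus 2 L))),
      Tendsto Ls atTop atTop →
      (∀ j, IsGroundStateInSector (hubbardTorusTT' (Ls j) t s₂ U₂) (rectN n (Ls j)) 0 (ψ (Ls j))) →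
      (∀ j, star (ψ (Ls j)) ⬝ᵥ ψ (Ls j) = 1) → ω.IsTorusLimitOf ψ Ls →
      J₂₂ ≤ ω.meanEnergy (hubbardTTPrimeFermionInteraction 0 1 0) 1 ∧
        B₂₂ ≤ (ω.expect ({0} : Finset (Site 2))
          (nAt 0 (Finset.mem_singleton_self 0) 0 * nAt 0 (Finset.mem_singleton_self 0) 1)).re) :
    energyDensityTT' t s U n ≤
      min (min (R₁₁ + K₁₁ * (s - s₁) + A₁₁ * (U - U₁)) (R₁₂ + K₁₂ * (s - s₁) - B₁₂ * (U₂ - U)))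
        (min (R₂₁ - J₂₁ * (s₂ - s) + A₂₁ * (U - U₁)) (R₂₂ - J₂₂ * (s₂ - s) - B₂₂ * (U₂ - U))) := by
  have hU : 0 ≤ U := hU₁0.trans hU₁
  have hU₂0 : 0 ≤ U₂ := hU.trans hU₂
  have hss₁ : 0 ≤ s - s₁ := sub_nonneg.2 hs₁
  have hss₂ : s - s₂ ≤ 0 := sub_nonpos.2 hs₂
  have hUU₁ : 0 ≤ U - U₁ := sub_nonneg.2 hU₁
  have hUU₂ : U - U₂ ≤ 0 := sub_nonpos.2 hU₂
  refine le_min (le_min ?_ ?_) (le_min ?_ ?_)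
  · have := energyDensityTT'_le_cornerPlane_of_forall_isTorusLimitOf_words t s₁ s hU₁0 hU hn0 hn2 hR₁₁
      (d := A₁₁) (τ := K₁₁) fun ω Ls ψ hLs hψ h1 hω => by
        obtain ⟨hk, ha⟩ := h₁₁ ω Ls ψ hLs hψ h1 hω
        exact add_le_add (mul_le_mul_of_nonneg_left ha hUU₁) (mul_le_mul_of_nonneg_left hk hss₁)
    linarith
  · have := energyDensityTT'_le_cornerPlane_of_forall_isTorusLimitOf_words t s₁ s hU₂0 hU hn0 hn2 hR₁₂
      (d := B₁₂) (τ := K₁₂) fun ω Ls ψ hLs hψ h1 hω => by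
        obtain ⟨hk, hb⟩ := h₁₂ ω Ls ψ hLs hψ h1 hω
        exact add_le_add (mul_le_mul_of_nonpos_left hb hUU₂) (mul_le_mul_of_nonneg_left hk hss₁)
    linarith
  · have := energyDensityTT'_le_cornerPlane_of_forall_isTorusLimitOf_words t s₂ s hU₁0 hU hn0 hn2 hR₂₁
      (d := A₂₁) (τ := J₂₁) fun ω Ls ψ hLs hψ h1 hω => by
        obtain ⟨hj, ha⟩ := h₂₁ ω Ls ψ hLs hψ h1 hω
        exact add_le_add (mul_le_mul_of_nonneg_left ha hUU₁) (mul_le_mul_of_nonpos_left hj hss₂)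
    linarith
  · have := energyDensityTT'_le_cornerPlane_of_forall_isTorusLimitOf_words t s₂ s hU₂0 hU hn0 hn2 hR₂₂
      (d := B₂₂) (τ := J₂₂) fun ω Ls ψ hLs hψ h1 hω => by
        obtain ⟨hj, hb⟩ := h₂₂ ω Ls ψ hLs hψ h1 hω
        exact add_le_add (mul_le_mul_of_nonpos_left hb hUU₂) (mul_le_mul_of_nonpos_left hj hss₂)
    linarith

/-- **Sourced cap through the canonical corner planes** (Legendre: `E(s,U,μ,h) ≤ e(1,s,U,n) − μn`): with the data
of `energyDensityTT'_rect_le_cornerPlanes_of_words` at `t = 1`, for every `(s,U)` in the rectangle and every `μ, h`: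
`E(s,U,μ,h) ≤ min(min P₁₁ P₁₂, min P₂₁ P₂₂) − μn`. [cite: Ruelle1969, §3.4] -/
theorem dWaveSourceEnergyDensityTT'_rect_le_of_canonical_cornerWords
    {s₁ s₂ U₁ U₂ s U : ℝ} (hU₁0 : 0 ≤ U₁) (hs₁ : s₁ ≤ s) (hs₂ : s ≤ s₂) (hU₁ : U₁ ≤ U) (hU₂ : U ≤ U₂)
    {n : ℝ} (hn0 : 0 ≤ n) (hn2 : n < 2) (μ h : ℝ) {R₁₁ R₂₁ R₁₂ R₂₂ K₁₁ K₁₂ J₂₁ J₂₂ A₁₁ A₂₁ B₁₂ B₂₂ : ℝ}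
    (hR₁₁ : energyDensityTT' 1 s₁ U₁ n ≤ R₁₁) (hR₂₁ : energyDensityTT' 1 s₂ U₁ n ≤ R₂₁)
    (hR₁₂ : energyDensityTT' 1 s₁ U₂ n ≤ R₁₂) (hR₂₂ : energyDensityTT' 1 s₂ U₂ n ≤ R₂₂)
    (h₁₁ : ∀ (ω : InfVolFermionState 2) (Ls : ℕ → ℕ) (ψ : ∀ L, Fock (Orb (FermionTorus 2 L))),
      Tendsto Ls atTop atTop →
      (∀ j, IsGroundStateInSector (hubbardTorusTT' (Ls j) 1 s₁ U₁) (rectN n (Ls j)) 0 (ψ (Ls j))) →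
      (∀ j, star (ψ (Ls j)) ⬝ᵥ ψ (Ls j) = 1) → ω.IsTorusLimitOf ψ Ls →
      ω.meanEnergy (hubbardTTPrimeFermionInteraction 0 1 0) 1 ≤ K₁₁ ∧
        (ω.expect ({0} : Finset (Site 2))
          (nAt 0 (Finset.mem_singleton_self 0) 0 * nAt 0 (Finset.mem_singleton_self 0) 1)).re ≤ A₁₁)
    (h₁₂ : ∀ (ω : InfVolFermionState 2) (Ls : ℕ → ℕ) (ψ : ∀ L, Fock (Orb (FermionTorus 2 L))),
      Tendsto Ls atTop atTop →
      (∀ j, IsGroundStateInSector (hubbardTorusTT' (Ls j) 1 s₁ U₂) (rectN n (Ls j)) 0 (ψ (Ls j))) →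
      (∀ j, star (ψ (Ls j)) ⬝ᵥ ψ (Ls j) = 1) → ω.IsTorusLimitOf ψ Ls →
      ω.meanEnergy (hubbardTTPrimeFermionInteraction 0 1 0) 1 ≤ K₁₂ ∧
        B₁₂ ≤ (ω.expect ({0} : Finset (Site 2))
          (nAt 0 (Finset.mem_singleton_self 0) 0 * nAt 0 (Finset.mem_singleton_self 0) 1)).re)
    (h₂₁ : ∀ (ω : InfVolFermionState 2) (Ls : ℕ → ℕ) (ψ : ∀ L, Fock (Orb (FermionTorus 2 L))),
      Tendsto Ls atTop atTop →
      (∀ j, IsGroundStateInSector (hubbardTorusTT' (Ls j) 1 s₂ U₁) (rectN n (Ls j)) 0 (ψ (Ls j))) →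
      (∀ j, star (ψ (Ls j)) ⬝ᵥ ψ (Ls j) = 1) → ω.IsTorusLimitOf ψ Ls →
      J₂₁ ≤ ω.meanEnergy (hubbardTTPrimeFermionInteraction 0 1 0) 1 ∧
        (ω.expect ({0} : Finset (Site 2))
          (nAt 0 (Finset.mem_singleton_self 0) 0 * nAt 0 (Finset.mem_singleton_self 0) 1)).re ≤ A₂₁)
    (h₂₂ : ∀ (ω : InfVolFermionState 2) (Ls : ℕ → ℕ) (ψ : ∀ L, Fock (Orb (FermionTorus 2 L))),
      Tendsto Ls atTop atTop →
      (∀ j, IsGroundStateInSector (hubbardTorusTT' (Ls j) 1 s₂ U₂) (rectN n (Ls j)) 0 (ψ (Ls j))) →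
      (∀ j, star (ψ (Ls j)) ⬝ᵥ ψ (Ls j) = 1) → ω.IsTorusLimitOf ψ Ls →
      J₂₂ ≤ ω.meanEnergy (hubbardTTPrimeFermionInteraction 0 1 0) 1 ∧
        B₂₂ ≤ (ω.expect ({0} : Finset (Site 2))
          (nAt 0 (Finset.mem_singleton_self 0) 0 * nAt 0 (Finset.mem_singleton_self 0) 1)).re) :
    dWaveSourceEnergyDensityTT' s U μ h ≤
      min (min (R₁₁ + K₁₁ * (s - s₁) + A₁₁ * (U - U₁)) (R₁₂ + K₁₂ * (s - s₁) - B₁₂ * (U₂ - U)))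
        (min (R₂₁ - J₂₁ * (s₂ - s) + A₂₁ * (U - U₁)) (R₂₂ - J₂₂ * (s₂ - s) - B₂₂ * (U₂ - U))) - μ * n :=
  dWaveSourceEnergyDensityTT'_le_of_energyDensityTT'_le s (hU₁0.trans hU₁) μ h hn0 hn2
    (energyDensityTT'_rect_le_cornerPlanes_of_words 1 hU₁0 hs₁ hs₂ hU₁ hU₂ hn0 hn2 hR₁₁ hR₂₁ hR₁₂ hR₂₂ h₁₁ h₁₂
      h₂₁ h₂₂)

end CapCanonical

/-! ### §4 Pointwise order-parameter and pair-amplitude ceilings on the rectangle -/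

section OrderPointwise

/-- **ORDER CEILING ON A `(t', U)` RECTANGLE, pointwise, grand-canonical corner words**: source-free caps
`E(sⱼ,Uᵢ,μ,0) ≤ hiⱼᵢ`, sourced floors `loⱼᵢ ≤ E(sⱼ,Uᵢ,μ,h)` (`h > 0`) and the one-sided slope words of §3 on the
source-free translation-invariant ground states at the four corners give, at every `(s,U) ∈ [s₁,s₂] × [U₁,U₂]`
(`s₁ < s₂`, `U₁ < U₂`), `m⋆(s,U,μ) ≤ (min(min P₁₁ P₁₂, min P₂₁ P₂₂) − bilinear(lo;s,U))/(2h)`. [cite: KomaTasaki1994, §1] -/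
theorem dWaveOrderParameterTT'_rect_le_of_cornerWords
    {s₁ s₂ U₁ U₂ μ h hi₁₁ hi₂₁ hi₁₂ hi₂₂ lo₁₁ lo₂₁ lo₁₂ lo₂₂ K₁₁ K₁₂ J₂₁ J₂₂ A₁₁ A₂₁ B₁₂ B₂₂ : ℝ}
    (hh : 0 < h) (hs : s₁ < s₂) (hUlt : U₁ < U₂)
    (hhi₁₁ : dWaveSourceEnergyDensityTT' s₁ U₁ μ 0 ≤ hi₁₁) (hhi₂₁ : dWaveSourceEnergyDensityTT' s₂ U₁ μ 0 ≤ hi₂₁)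
    (hhi₁₂ : dWaveSourceEnergyDensityTT' s₁ U₂ μ 0 ≤ hi₁₂) (hhi₂₂ : dWaveSourceEnergyDensityTT' s₂ U₂ μ 0 ≤ hi₂₂)
    (hlo₁₁ : lo₁₁ ≤ dWaveSourceEnergyDensityTT' s₁ U₁ μ h) (hlo₂₁ : lo₂₁ ≤ dWaveSourceEnergyDensityTT' s₂ U₁ μ h)
    (hlo₁₂ : lo₁₂ ≤ dWaveSourceEnergyDensityTT' s₁ U₂ μ h) (hlo₂₂ : lo₂₂ ≤ dWaveSourceEnergyDensityTT' s₂ U₂ μ h)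
    (h₁₁ : ∀ ω : InfVolFermionState 2,
      ω.IsMeanEnergyMinimiser (hubbardTTPrimeSourcedInteraction 1 s₁ U₁ μ dWaveFormFactor 0) 1 →
        ω.meanEnergy (hubbardTTPrimeFermionInteraction 0 1 0) 1 ≤ K₁₁ ∧
          ω.meanEnergy (hubbardTTPrimeFermionInteraction 0 0 1) 1 ≤ A₁₁)
    (h₁₂ : ∀ ω : InfVolFermionState 2,
      ω.IsMeanEnergyMinimiser (hubbardTTPrimeSourcedInteraction 1 s₁ U₂ μ dWaveFormFactor 0) 1 →
        ω.meanEnergy (hubbardTTPrimeFermionInteraction 0 1 0) 1 ≤ K₁₂ ∧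
          B₁₂ ≤ ω.meanEnergy (hubbardTTPrimeFermionInteraction 0 0 1) 1)
    (h₂₁ : ∀ ω : InfVolFermionState 2,
      ω.IsMeanEnergyMinimiser (hubbardTTPrimeSourcedInteraction 1 s₂ U₁ μ dWaveFormFactor 0) 1 →
        J₂₁ ≤ ω.meanEnergy (hubbardTTPrimeFermionInteraction 0 1 0) 1 ∧
          ω.meanEnergy (hubbardTTPrimeFermionInteraction 0 0 1) 1 ≤ A₂₁)
    (h₂₂ : ∀ ω : InfVolFermionState 2,
      ω.IsMeanEnergyMinimiser (hubbardTTPrimeSourcedInteraction 1 s₂ U₂ μ dWaveFormFactor 0) 1 →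
        J₂₂ ≤ ω.meanEnergy (hubbardTTPrimeFermionInteraction 0 1 0) 1 ∧
          B₂₂ ≤ ω.meanEnergy (hubbardTTPrimeFermionInteraction 0 0 1) 1)
    {s U : ℝ} (hs₁ : s₁ ≤ s) (hs₂ : s ≤ s₂) (hU₁ : U₁ ≤ U) (hU₂ : U ≤ U₂) :
    dWaveOrderParameterTT' s U μ ≤
      (min (min (hi₁₁ + K₁₁ * (s - s₁) + A₁₁ * (U - U₁)) (hi₁₂ + K₁₂ * (s - s₁) - B₁₂ * (U₂ - U)))
          (min (hi₂₁ - J₂₁ * (s₂ - s) + A₂₁ * (U - U₁)) (hi₂₂ - J₂₂ * (s₂ - s) - B₂₂ * (U₂ - U))) -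
        ((lo₁₁ + (lo₂₁ - lo₁₁) * (s - s₁) / (s₂ - s₁)) +
          ((lo₁₂ + (lo₂₂ - lo₁₂) * (s - s₁) / (s₂ - s₁)) - (lo₁₁ + (lo₂₁ - lo₁₁) * (s - s₁) / (s₂ - s₁))) *
            (U - U₁) / (U₂ - U₁))) / (2 * h) :=
  dWaveOrderParameterTT'_le_of_windows s U μ hh
    (dWaveSourceEnergyDensityTT'_rect_ge_bilinear hs hUlt hs₁ hs₂ hU₁ hU₂ hlo₁₁ hlo₂₁ hlo₁₂ hlo₂₂)
    (dWaveSourceEnergyDensityTT'_rect_le_cornerPlanes_of_words hs₁ hs₂ hU₁ hU₂ hhi₁₁ hhi₂₁ hhi₁₂ hhi₂₂ h₁₁ h₁₂ h₂₁ h₂₂)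

/-- **ORDER CEILING ON A `(t', U)` RECTANGLE, pointwise, CANONICAL corner words** (caps `Rⱼᵢ ≥ e(1,sⱼ,Uᵢ,n)`,
registry `K₂` / docc rows at the corners, `U₁ ≥ 0`, `0 ≤ n < 2`): at every `(s,U)` in the rectangle,
`m⋆(s,U,μ) ≤ (min(min P₁₁ P₁₂, min P₂₁ P₂₂) − μn − bilinear(lo;s,U))/(2h)`. [cite: KomaTasaki1994, §1] -/
theorem dWaveOrderParameterTT'_rect_le_of_canonical_cornerWords {s₁ s₂ U₁ U₂ : ℝ} (hU₁0 : 0 ≤ U₁)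
    (hs : s₁ < s₂) (hUlt : U₁ < U₂) {n : ℝ} (hn0 : 0 ≤ n) (hn2 : n < 2) {μ h : ℝ} (hh : 0 < h)
    {R₁₁ R₂₁ R₁₂ R₂₂ lo₁₁ lo₂₁ lo₁₂ lo₂₂ K₁₁ K₁₂ J₂₁ J₂₂ A₁₁ A₂₁ B₁₂ B₂₂ : ℝ}
    (hR₁₁ : energyDensityTT' 1 s₁ U₁ n ≤ R₁₁) (hR₂₁ : energyDensityTT' 1 s₂ U₁ n ≤ R₂₁)
    (hR₁₂ : energyDensityTT' 1 s₁ U₂ n ≤ R₁₂) (hR₂₂ : energyDensityTT' 1 s₂ U₂ n ≤ R₂₂)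
    (h₁₁ : ∀ (ω : InfVolFermionState 2) (Ls : ℕ → ℕ) (ψ : ∀ L, Fock (Orb (FermionTorus 2 L))),
      Tendsto Ls atTop atTop →
      (∀ j, IsGroundStateInSector (hubbardTorusTT' (Ls j) 1 s₁ U₁) (rectN n (Ls j)) 0 (ψ (Ls j))) →
      (∀ j, star (ψ (Ls j)) ⬝ᵥ ψ (Ls j) = 1) → ω.IsTorusLimitOf ψ Ls →
      ω.meanEnergy (hubbardTTPrimeFermionInteraction 0 1 0) 1 ≤ K₁₁ ∧
        (ω.expect ({0} : Finset (Site 2))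
          (nAt 0 (Finset.mem_singleton_self 0) 0 * nAt 0 (Finset.mem_singleton_self 0) 1)).re ≤ A₁₁)
    (h₁₂ : ∀ (ω : InfVolFermionState 2) (Ls : ℕ → ℕ) (ψ : ∀ L, Fock (Orb (FermionTorus 2 L))),
      Tendsto Ls atTop atTop →
      (∀ j, IsGroundStateInSector (hubbardTorusTT' (Ls j) 1 s₁ U₂) (rectN n (Ls j)) 0 (ψ (Ls j))) →
      (∀ j, star (ψ (Ls j)) ⬝ᵥ ψ (Ls j) = 1) → ω.IsTorusLimitOf ψ Ls →
      ω.meanEnergy (hubbardTTPrimeFermionInteraction 0 1 0) 1 ≤ K₁₂ ∧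
        B₁₂ ≤ (ω.expect ({0} : Finset (Site 2))
          (nAt 0 (Finset.mem_singleton_self 0) 0 * nAt 0 (Finset.mem_singleton_self 0) 1)).re)
    (h₂₁ : ∀ (ω : InfVolFermionState 2) (Ls : ℕ → ℕ) (ψ : ∀ L, Fock (Orb (FermionTorus 2 L))),
      Tendsto Ls atTop atTop →
      (∀ j, IsGroundStateInSector (hubbardTorusTT' (Ls j) 1 s₂ U₁) (rectN n (Ls j)) 0 (ψ (Ls j))) →
      (∀ j, star (ψ (Ls j)) ⬝ᵥ ψ (Ls j) = 1) → ω.IsTorusLimitOf ψ Ls →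
      J₂₁ ≤ ω.meanEnergy (hubbardTTPrimeFermionInteraction 0 1 0) 1 ∧
        (ω.expect ({0} : Finset (Site 2))
          (nAt 0 (Finset.mem_singleton_self 0) 0 * nAt 0 (Finset.mem_singleton_self 0) 1)).re ≤ A₂₁)
    (h₂₂ : ∀ (ω : InfVolFermionState 2) (Ls : ℕ → ℕ) (ψ : ∀ L, Fock (Orb (FermionTorus 2 L))),
      Tendsto Ls atTop atTop →
      (∀ j, IsGroundStateInSector (hubbardTorusTT' (Ls j) 1 s₂ U₂) (rectN n (Ls j)) 0 (ψ (Ls j))) →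
      (∀ j, star (ψ (Ls j)) ⬝ᵥ ψ (Ls j) = 1) → ω.IsTorusLimitOf ψ Ls →
      J₂₂ ≤ ω.meanEnergy (hubbardTTPrimeFermionInteraction 0 1 0) 1 ∧
        B₂₂ ≤ (ω.expect ({0} : Finset (Site 2))
          (nAt 0 (Finset.mem_singleton_self 0) 0 * nAt 0 (Finset.mem_singleton_self 0) 1)).re)
    (hlo₁₁ : lo₁₁ ≤ dWaveSourceEnergyDensityTT' s₁ U₁ μ h) (hlo₂₁ : lo₂₁ ≤ dWaveSourceEnergyDensityTT' s₂ U₁ μ h)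
    (hlo₁₂ : lo₁₂ ≤ dWaveSourceEnergyDensityTT' s₁ U₂ μ h) (hlo₂₂ : lo₂₂ ≤ dWaveSourceEnergyDensityTT' s₂ U₂ μ h)
    {s U : ℝ} (hs₁ : s₁ ≤ s) (hs₂ : s ≤ s₂) (hU₁ : U₁ ≤ U) (hU₂ : U ≤ U₂) :
    dWaveOrderParameterTT' s U μ ≤
      (min (min (R₁₁ + K₁₁ * (s - s₁) + A₁₁ * (U - U₁)) (R₁₂ + K₁₂ * (s - s₁) - B₁₂ * (U₂ - U)))
          (min (R₂₁ - J₂₁ * (s₂ - s) + A₂₁ * (U - U₁)) (R₂₂ - J₂₂ * (s₂ - s) - B₂₂ * (U₂ - U))) - μ * n -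
        ((lo₁₁ + (lo₂₁ - lo₁₁) * (s - s₁) / (s₂ - s₁)) +
          ((lo₁₂ + (lo₂₂ - lo₁₂) * (s - s₁) / (s₂ - s₁)) - (lo₁₁ + (lo₂₁ - lo₁₁) * (s - s₁) / (s₂ - s₁))) *
            (U - U₁) / (U₂ - U₁))) / (2 * h) :=
  dWaveOrderParameterTT'_le_of_windows s U μ hh
    (dWaveSourceEnergyDensityTT'_rect_ge_bilinear hs hUlt hs₁ hs₂ hU₁ hU₂ hlo₁₁ hlo₂₁ hlo₁₂ hlo₂₂)
    (dWaveSourceEnergyDensityTT'_rect_le_of_canonical_cornerWords hU₁0 hs₁ hs₂ hU₁ hU₂ hn0 hn2 μ 0 hR₁₁ hR₂₁ hR₁₂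
      hR₂₂ h₁₁ h₁₂ h₂₁ h₂₂)

/-- **PAIR-AMPLITUDE CEILING ON A `(t', U) × [μ₁,μ₂]` CELL of object M, CANONICAL corner words** (the shape the
downfold order seam consumes): with the canonical data of the previous theorem (sourced floors `loⱼᵢ` certified at the
UPPER chemical potential `μ₂`), every translation-invariant `ε`-near-minimiser `σ` of source-free object M at
`(1, t', t'', U, μ')` with `(t',U) ∈ [s₁,s₂] × [U₁,U₂]`, `μ' ∈ [μ₁,μ₂]` has
`e_P(σ) ≤ (min(min P₁₁ P₁₂, min P₂₁ P₂₂)(t',U) − μ₁n − bilinear(lo;t',U) + (32/π²)|t''| + ε)/h` — no `t'`-offset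
term: the rectangle carries the `t'`-extent. [cite: KomaTasaki1994, §1] -/
theorem meanEnergy_pairSource_le_of_rect_mu_cell_canonical_cornerWords {s₁ s₂ U₁ U₂ : ℝ} (hU₁0 : 0 ≤ U₁)
    (hs : s₁ < s₂) (hUlt : U₁ < U₂) {n : ℝ} (hn0 : 0 ≤ n) (hn2 : n < 2) {μ₁ μ₂ h : ℝ} (hh : 0 < h)
    {R₁₁ R₂₁ R₁₂ R₂₂ lo₁₁ lo₂₁ lo₁₂ lo₂₂ K₁₁ K₁₂ J₂₁ J₂₂ A₁₁ A₂₁ B₁₂ B₂₂ : ℝ}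
    (hR₁₁ : energyDensityTT' 1 s₁ U₁ n ≤ R₁₁) (hR₂₁ : energyDensityTT' 1 s₂ U₁ n ≤ R₂₁)
    (hR₁₂ : energyDensityTT' 1 s₁ U₂ n ≤ R₁₂) (hR₂₂ : energyDensityTT' 1 s₂ U₂ n ≤ R₂₂)
    (h₁₁ : ∀ (ω : InfVolFermionState 2) (Ls : ℕ → ℕ) (ψ : ∀ L, Fock (Orb (FermionTorus 2 L))),
      Tendsto Ls atTop atTop →
      (∀ j, IsGroundStateInSector (hubbardTorusTT' (Ls j) 1 s₁ U₁) (rectN n (Ls j)) 0 (ψ (Ls j))) →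
      (∀ j, star (ψ (Ls j)) ⬝ᵥ ψ (Ls j) = 1) → ω.IsTorusLimitOf ψ Ls →
      ω.meanEnergy (hubbardTTPrimeFermionInteraction 0 1 0) 1 ≤ K₁₁ ∧
        (ω.expect ({0} : Finset (Site 2))
          (nAt 0 (Finset.mem_singleton_self 0) 0 * nAt 0 (Finset.mem_singleton_self 0) 1)).re ≤ A₁₁)
    (h₁₂ : ∀ (ω : InfVolFermionState 2) (Ls : ℕ → ℕ) (ψ : ∀ L, Fock (Orb (FermionTorus 2 L))),
      Tendsto Ls atTop atTop →
      (∀ j, IsGroundStateInSector (hubbardTorusTT' (Ls j) 1 s₁ U₂) (rectN n (Ls j)) 0 (ψ (Ls j))) →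
      (∀ j, star (ψ (Ls j)) ⬝ᵥ ψ (Ls j) = 1) → ω.IsTorusLimitOf ψ Ls →
      ω.meanEnergy (hubbardTTPrimeFermionInteraction 0 1 0) 1 ≤ K₁₂ ∧
        B₁₂ ≤ (ω.expect ({0} : Finset (Site 2))
          (nAt 0 (Finset.mem_singleton_self 0) 0 * nAt 0 (Finset.mem_singleton_self 0) 1)).re)
    (h₂₁ : ∀ (ω : InfVolFermionState 2) (Ls : ℕ → ℕ) (ψ : ∀ L, Fock (Orb (FermionTorus 2 L))),
      Tendsto Ls atTop atTop →
      (∀ j, IsGroundStateInSector (hubbardTorusTT' (Ls j) 1 s₂ U₁) (rectN n (Ls j)) 0 (ψ (Ls j))) →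
      (∀ j, star (ψ (Ls j)) ⬝ᵥ ψ (Ls j) = 1) → ω.IsTorusLimitOf ψ Ls →
      J₂₁ ≤ ω.meanEnergy (hubbardTTPrimeFermionInteraction 0 1 0) 1 ∧
        (ω.expect ({0} : Finset (Site 2))
          (nAt 0 (Finset.mem_singleton_self 0) 0 * nAt 0 (Finset.mem_singleton_self 0) 1)).re ≤ A₂₁)
    (h₂₂ : ∀ (ω : InfVolFermionState 2) (Ls : ℕ → ℕ) (ψ : ∀ L, Fock (Orb (FermionTorus 2 L))),
      Tendsto Ls atTop atTop →
      (∀ j, IsGroundStateInSector (hubbardTorusTT' (Ls j) 1 s₂ U₂) (rectN n (Ls j)) 0 (ψ (Ls j))) →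
      (∀ j, star (ψ (Ls j)) ⬝ᵥ ψ (Ls j) = 1) → ω.IsTorusLimitOf ψ Ls →
      J₂₂ ≤ ω.meanEnergy (hubbardTTPrimeFermionInteraction 0 1 0) 1 ∧
        B₂₂ ≤ (ω.expect ({0} : Finset (Site 2))
          (nAt 0 (Finset.mem_singleton_self 0) 0 * nAt 0 (Finset.mem_singleton_self 0) 1)).re)
    (hlo₁₁ : lo₁₁ ≤ dWaveSourceEnergyDensityTT' s₁ U₁ μ₂ h) (hlo₂₁ : lo₂₁ ≤ dWaveSourceEnergyDensityTT' s₂ U₁ μ₂ h)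
    (hlo₁₂ : lo₁₂ ≤ dWaveSourceEnergyDensityTT' s₁ U₂ μ₂ h) (hlo₂₂ : lo₂₂ ≤ dWaveSourceEnergyDensityTT' s₂ U₂ μ₂ h)
    {t' U μ' : ℝ} (hs₁ : s₁ ≤ t') (hs₂ : t' ≤ s₂) (hU₁ : U₁ ≤ U) (hU₂ : U ≤ U₂) (hμ₁ : μ₁ ≤ μ') (hμ₂ : μ' ≤ μ₂)
    (t'' : ℝ) {ε : ℝ} {σ : InfVolFermionState 2} (hσ : σ.IsTranslationInvariant)
    (hε : σ.meanEnergy (hubbardTT'T''SourcedInteraction 1 t' t'' U μ' dWaveFormFactor 0) 2 ≤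
      (hubbardTT'T''SourcedInteraction 1 t' t'' U μ' dWaveFormFactor 0).tiGroundEnergyDensity 2 + ε) :
    σ.meanEnergy (pairSourceInteraction dWaveFormFactor) 1 ≤
      (min (min (R₁₁ + K₁₁ * (t' - s₁) + A₁₁ * (U - U₁)) (R₁₂ + K₁₂ * (t' - s₁) - B₁₂ * (U₂ - U)))
          (min (R₂₁ - J₂₁ * (s₂ - t') + A₂₁ * (U - U₁)) (R₂₂ - J₂₂ * (s₂ - t') - B₂₂ * (U₂ - U))) - μ₁ * n -
        ((lo₁₁ + (lo₂₁ - lo₁₁) * (t' - s₁) / (s₂ - s₁)) +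
          ((lo₁₂ + (lo₂₂ - lo₁₂) * (t' - s₁) / (s₂ - s₁)) - (lo₁₁ + (lo₂₁ - lo₁₁) * (t' - s₁) / (s₂ - s₁))) *
            (U - U₁) / (U₂ - U₁)) +
        32 / Real.pi ^ 2 * |t''| + ε) / h := by
  have hcap := (dWaveSourceEnergyDensityTT'_antitone_mu t' U 0 hμ₁).trans
    (dWaveSourceEnergyDensityTT'_rect_le_of_canonical_cornerWords hU₁0 hs₁ hs₂ hU₁ hU₂ hn0 hn2 μ₁ 0 hR₁₁ hR₂₁ hR₁₂
      hR₂₂ h₁₁ h₁₂ h₂₁ h₂₂)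
  have hfl := (dWaveSourceEnergyDensityTT'_rect_ge_bilinear hs hUlt hs₁ hs₂ hU₁ hU₂ hlo₁₁ hlo₂₁ hlo₁₂ hlo₂₂).trans
    (dWaveSourceEnergyDensityTT'_antitone_mu t' U h hμ₂)
  refine (meanEnergy_pairSource_le_secant_tpp t' U μ' t'' hh hσ hε).trans (div_le_div_of_nonneg_right ?_ hh.le)
  linarith

end OrderPointwise

/-! ### §5 The uniform nested bulge: a `U`-bulge per column, then a `t'`-bulge across -/

section NestedBulge

/-- The harmonic bulge `H(a,b) = a⁺b⁺/(a⁺ + b⁺)` is non-decreasing in each argument. [cite: Neumaier2004CompleteSearch, §11] -/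
theorem harmonicBulge_mono {a a' b b' : ℝ} (ha : a ≤ a') (hb : b ≤ b') :
    max a 0 * max b 0 / (max a 0 + max b 0) ≤ max a' 0 * max b' 0 / (max a' 0 + max b' 0) := by
  set p := max a 0
  set q := max b 0
  set p' := max a' 0
  set q' := max b' 0
  have hp : 0 ≤ p := le_max_right _ _
  have hq : 0 ≤ q := le_max_right _ _
  have hpp : p ≤ p' := max_le_max ha le_rfl
  have hqq : q ≤ q' := max_le_max hb le_rfl
  have hp' : 0 ≤ p' := hp.trans hpp
  have hq' : 0 ≤ q' := hq.trans hqq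
  rcases (add_nonneg hp hq).eq_or_lt with h0 | hpos
  · rw [← h0, div_zero]
    exact div_nonneg (mul_nonneg hp' hq') (add_nonneg hp' hq')
  · have hpos' : 0 < p' + q' := hpos.trans_le (add_le_add hpp hqq)
    rw [div_le_div_iff₀ hpos hpos']
    -- `p q (p' + q') ≤ p' q' (p + q)`: `p p' (q − q') + q q' (p − p') ≤ 0`
    nlinarith [mul_nonneg (mul_nonneg hp hp') (sub_nonneg.2 hqq), mul_nonneg (mul_nonneg hq hq') (sub_nonneg.2 hpp)]

/-- **Column step** (algebra): two `U`-tangents `P + A(U − U₁)`, `Q − B(U₂ − U)` above a `U`-chord of `Λ₁, Λ₂`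
whose slope `σ = (Λ₂ − Λ₁)/(U₂ − U₁)` is only known to lie in `[σ⁻, σ⁺]`: the numerator is at most
`max(P − Λ₁, Q − Λ₂) + (U₂ − U₁)·H(A − σ⁻, σ⁺ − B)`. [cite: Neumaier2004CompleteSearch, §11] -/
theorem min_tangents_sub_chord_le_bulge_of_slope_mem {P Q A B Λ₁ Λ₂ U₁ U₂ U σm σM : ℝ} (hUlt : U₁ < U₂)
    (hU₁ : U₁ ≤ U) (hU₂ : U ≤ U₂) (hσm : σm ≤ (Λ₂ - Λ₁) / (U₂ - U₁)) (hσM : (Λ₂ - Λ₁) / (U₂ - U₁) ≤ σM) :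
    min (P + A * (U - U₁)) (Q - B * (U₂ - U)) - (Λ₁ + (Λ₂ - Λ₁) * (U - U₁) / (U₂ - U₁)) ≤
      max (P - Λ₁) (Q - Λ₂) + (U₂ - U₁) * (max (A - σm) 0 * max (σM - B) 0) / (max (A - σm) 0 + max (σM - B) 0) := by
  have h1 := min_tangents_sub_chord_le_bulge (hi₁ := P) (hi₂ := Q) (lo₁ := Λ₁) (lo₂ := Λ₂) (A := A) (B := B)
    hUlt hU₁ hU₂
  have h2 := harmonicBulge_mono (a := A - (Λ₂ - Λ₁) / (U₂ - U₁)) (a' := A - σm)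
    (b := (Λ₂ - Λ₁) / (U₂ - U₁) - B) (b' := σM - B) (by linarith) (by linarith)
  have h3 := mul_le_mul_of_nonneg_left h2 (sub_nonneg.2 hUlt.le)
  have e1 : (U₂ - U₁) * (max (A - (Λ₂ - Λ₁) / (U₂ - U₁)) 0 * max ((Λ₂ - Λ₁) / (U₂ - U₁) - B) 0) /
        (max (A - (Λ₂ - Λ₁) / (U₂ - U₁)) 0 + max ((Λ₂ - Λ₁) / (U₂ - U₁) - B) 0) =
      (U₂ - U₁) * (max (A - (Λ₂ - Λ₁) / (U₂ - U₁)) 0 * max ((Λ₂ - Λ₁) / (U₂ - U₁) - B) 0 /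
        (max (A - (Λ₂ - Λ₁) / (U₂ - U₁)) 0 + max ((Λ₂ - Λ₁) / (U₂ - U₁) - B) 0)) := mul_div_assoc _ _ _
  have e2 : (U₂ - U₁) * (max (A - σm) 0 * max (σM - B) 0) / (max (A - σm) 0 + max (σM - B) 0) =
      (U₂ - U₁) * (max (A - σm) 0 * max (σM - B) 0 / (max (A - σm) 0 + max (σM - B) 0)) := mul_div_assoc _ _ _
  linarith [h1, h3, e1, e2]

/-- **The interior column's sourced `U`-secant slope interpolates the two columns' slopes** (algebra): with the
row chords `Λᵢ(s) = lo₁ᵢ + (lo₂ᵢ − lo₁ᵢ)(s − s₁)/(s₂ − s₁)`, the slope `(Λ₂(s) − Λ₁(s))/(U₂ − U₁)` lies between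
`min` and `max` of `(lo₁₂ − lo₁₁)/(U₂ − U₁)` and `(lo₂₂ − lo₂₁)/(U₂ − U₁)`. [cite: Neumaier2004CompleteSearch, §11] -/
theorem rowChords_secant_mem {lo₁₁ lo₂₁ lo₁₂ lo₂₂ s₁ s₂ s U₁ U₂ : ℝ} (hs : s₁ < s₂) (hs₁ : s₁ ≤ s) (hs₂ : s ≤ s₂) :
    min ((lo₁₂ - lo₁₁) / (U₂ - U₁)) ((lo₂₂ - lo₂₁) / (U₂ - U₁)) ≤
        ((lo₁₂ + (lo₂₂ - lo₁₂) * (s - s₁) / (s₂ - s₁)) - (lo₁₁ + (lo₂₁ - lo₁₁) * (s - s₁) / (s₂ - s₁))) /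
          (U₂ - U₁) ∧
      ((lo₁₂ + (lo₂₂ - lo₁₂) * (s - s₁) / (s₂ - s₁)) - (lo₁₁ + (lo₂₁ - lo₁₁) * (s - s₁) / (s₂ - s₁))) /
          (U₂ - U₁) ≤
        max ((lo₁₂ - lo₁₁) / (U₂ - U₁)) ((lo₂₂ - lo₂₁) / (U₂ - U₁)) := by
  have hws : 0 < s₂ - s₁ := sub_pos.2 hs
  set θ := (s - s₁) / (s₂ - s₁) with hθ
  have hθ0 : 0 ≤ θ := div_nonneg (sub_nonneg.2 hs₁) hws.le
  have hθ1 : θ ≤ 1 := by rw [hθ, div_le_one hws]; linarith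
  have e : ((lo₁₂ + (lo₂₂ - lo₁₂) * (s - s₁) / (s₂ - s₁)) - (lo₁₁ + (lo₂₁ - lo₁₁) * (s - s₁) / (s₂ - s₁))) /
        (U₂ - U₁) =
      (1 - θ) * ((lo₁₂ - lo₁₁) / (U₂ - U₁)) + θ * ((lo₂₂ - lo₂₁) / (U₂ - U₁)) := by
    rw [hθ]
    field_simp
    ring
  rw [e]
  set x := (lo₁₂ - lo₁₁) / (U₂ - U₁)
  set y := (lo₂₂ - lo₂₁) / (U₂ - U₁)
  have h1θ : 0 ≤ 1 - θ := sub_nonneg.2 hθ1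
  constructor
  · have a := mul_le_mul_of_nonneg_left (min_le_left x y) h1θ
    have b := mul_le_mul_of_nonneg_left (min_le_right x y) hθ0
    linarith
  · have a := mul_le_mul_of_nonneg_left (le_max_left x y) h1θ
    have b := mul_le_mul_of_nonneg_left (le_max_right x y) hθ0
    linarith

/-- **Left-column gaps are affine in `s`** (algebra): `max(hi₁₁ + K₁₁(s − s₁) − Λ₁(s), hi₁₂ + K₁₂(s − s₁) − Λ₂(s))
≤ max(hi₁₁ − lo₁₁, hi₁₂ − lo₁₂) + (s − s₁)·max(K₁₁ − σ_{s,1}, K₁₂ − σ_{s,2})`, `σ_{s,i} = (lo₂ᵢ − lo₁ᵢ)/(s₂ − s₁)`.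
[cite: Neumaier2004CompleteSearch, §11] -/
theorem leftColumn_gaps_le {hi₁₁ hi₁₂ lo₁₁ lo₂₁ lo₁₂ lo₂₂ K₁₁ K₁₂ s₁ s₂ s : ℝ} (hs₁ : s₁ ≤ s) :
    max (hi₁₁ + K₁₁ * (s - s₁) - (lo₁₁ + (lo₂₁ - lo₁₁) * (s - s₁) / (s₂ - s₁)))
        (hi₁₂ + K₁₂ * (s - s₁) - (lo₁₂ + (lo₂₂ - lo₁₂) * (s - s₁) / (s₂ - s₁))) ≤
      max (hi₁₁ - lo₁₁) (hi₁₂ - lo₁₂) +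
        (s - s₁) * max (K₁₁ - (lo₂₁ - lo₁₁) / (s₂ - s₁)) (K₁₂ - (lo₂₂ - lo₁₂) / (s₂ - s₁)) := by
  have hss : 0 ≤ s - s₁ := sub_nonneg.2 hs₁
  have e₁ : (lo₂₁ - lo₁₁) * (s - s₁) / (s₂ - s₁) = (lo₂₁ - lo₁₁) / (s₂ - s₁) * (s - s₁) := by ring
  have e₂ : (lo₂₂ - lo₁₂) * (s - s₁) / (s₂ - s₁) = (lo₂₂ - lo₁₂) / (s₂ - s₁) * (s - s₁) := by ring
  rw [e₁, e₂]
  refine max_le ?_ ?_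
  · have a := le_max_left (hi₁₁ - lo₁₁) (hi₁₂ - lo₁₂)
    have b := mul_le_mul_of_nonneg_left
      (le_max_left (K₁₁ - (lo₂₁ - lo₁₁) / (s₂ - s₁)) (K₁₂ - (lo₂₂ - lo₁₂) / (s₂ - s₁))) hss
    linarith
  · have a := le_max_right (hi₁₁ - lo₁₁) (hi₁₂ - lo₁₂)
    have b := mul_le_mul_of_nonneg_left
      (le_max_right (K₁₁ - (lo₂₁ - lo₁₁) / (s₂ - s₁)) (K₁₂ - (lo₂₂ - lo₁₂) / (s₂ - s₁))) hss
    linarith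

/-- **Right-column gaps are affine in `s`** (algebra): `max(hi₂₁ − J₂₁(s₂ − s) − Λ₁(s), hi₂₂ − J₂₂(s₂ − s) − Λ₂(s))
≤ max(hi₂₁ − lo₂₁, hi₂₂ − lo₂₂) + (s₂ − s)·max(σ_{s,1} − J₂₁, σ_{s,2} − J₂₂)` (`s₁ < s₂`).
[cite: Neumaier2004CompleteSearch, §11] -/
theorem rightColumn_gaps_le {hi₂₁ hi₂₂ lo₁₁ lo₂₁ lo₁₂ lo₂₂ J₂₁ J₂₂ s₁ s₂ s : ℝ} (hs : s₁ < s₂) (hs₂ : s ≤ s₂) :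
    max (hi₂₁ - J₂₁ * (s₂ - s) - (lo₁₁ + (lo₂₁ - lo₁₁) * (s - s₁) / (s₂ - s₁)))
        (hi₂₂ - J₂₂ * (s₂ - s) - (lo₁₂ + (lo₂₂ - lo₁₂) * (s - s₁) / (s₂ - s₁))) ≤
      max (hi₂₁ - lo₂₁) (hi₂₂ - lo₂₂) +
        (s₂ - s) * max ((lo₂₁ - lo₁₁) / (s₂ - s₁) - J₂₁) ((lo₂₂ - lo₁₂) / (s₂ - s₁) - J₂₂) := by
  have hws : s₂ - s₁ ≠ 0 := ne_of_gt (sub_pos.2 hs)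
  have hss : 0 ≤ s₂ - s := sub_nonneg.2 hs₂
  have e₁ : lo₁₁ + (lo₂₁ - lo₁₁) * (s - s₁) / (s₂ - s₁) = lo₂₁ - (lo₂₁ - lo₁₁) / (s₂ - s₁) * (s₂ - s) := by
    field_simp
    ring
  have e₂ : lo₁₂ + (lo₂₂ - lo₁₂) * (s - s₁) / (s₂ - s₁) = lo₂₂ - (lo₂₂ - lo₁₂) / (s₂ - s₁) * (s₂ - s) := by
    field_simp
    ring
  rw [e₁, e₂]
  refine max_le ?_ ?_
  · have a := le_max_left (hi₂₁ - lo₂₁) (hi₂₂ - lo₂₂)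
    have b := mul_le_mul_of_nonneg_left
      (le_max_left ((lo₂₁ - lo₁₁) / (s₂ - s₁) - J₂₁) ((lo₂₂ - lo₁₂) / (s₂ - s₁) - J₂₂)) hss
    linarith
  · have a := le_max_right (hi₂₁ - lo₂₁) (hi₂₂ - lo₂₂)
    have b := mul_le_mul_of_nonneg_left
      (le_max_right ((lo₂₁ - lo₁₁) / (s₂ - s₁) - J₂₁) ((lo₂₂ - lo₁₂) / (s₂ - s₁) - J₂₂)) hss
    linarith

/-- **THE NESTED BULGE (algebra).** For `s₁ < s₂`, `U₁ < U₂` and `(s,U)` in the rectangle, the §4 numerator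
`min(min P₁₁ P₁₂, min P₂₁ P₂₂) − bilinear(lo;s,U)` is at most
`max(G₁ + w_U·H(A₁₁ − σ⁻, σ⁺ − B₁₂), G₂ + w_U·H(A₂₁ − σ⁻, σ⁺ − B₂₂)) + w_s·H(a₁, b₂)`, where
`Gⱼ = max(hiⱼ₁ − loⱼ₁, hiⱼ₂ − loⱼ₂)`, `σ⁻ = min σ_{U,1} σ_{U,2}`, `σ⁺ = max σ_{U,1} σ_{U,2}`, `σ_{U,j} = (loⱼ₂ − loⱼ₁)/w_U`,
`a₁ = max(K₁₁ − σ_{s,1}, K₁₂ − σ_{s,2})`, `b₂ = max(σ_{s,1} − J₂₁, σ_{s,2} − J₂₂)`, `σ_{s,i} = (lo₂ᵢ − lo₁ᵢ)/w_s`,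
`H(a,b) = a⁺b⁺/(a⁺ + b⁺)` (a `U`-bulge inside each column's pair of planes, the interior column's secant slope
interpolating the two columns' slopes, then the `t'`-bulge across). [cite: Neumaier2004CompleteSearch, §11] -/
theorem min_cornerPlanes_sub_bilinear_le_nestedBulge
    {s₁ s₂ U₁ U₂ s U hi₁₁ hi₂₁ hi₁₂ hi₂₂ lo₁₁ lo₂₁ lo₁₂ lo₂₂ K₁₁ K₁₂ J₂₁ J₂₂ A₁₁ A₂₁ B₁₂ B₂₂ : ℝ}
    (hs : s₁ < s₂) (hUlt : U₁ < U₂) (hs₁ : s₁ ≤ s) (hs₂ : s ≤ s₂) (hU₁ : U₁ ≤ U) (hU₂ : U ≤ U₂) :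
    min (min (hi₁₁ + K₁₁ * (s - s₁) + A₁₁ * (U - U₁)) (hi₁₂ + K₁₂ * (s - s₁) - B₁₂ * (U₂ - U)))
          (min (hi₂₁ - J₂₁ * (s₂ - s) + A₂₁ * (U - U₁)) (hi₂₂ - J₂₂ * (s₂ - s) - B₂₂ * (U₂ - U))) -
        ((lo₁₁ + (lo₂₁ - lo₁₁) * (s - s₁) / (s₂ - s₁)) +
          ((lo₁₂ + (lo₂₂ - lo₁₂) * (s - s₁) / (s₂ - s₁)) - (lo₁₁ + (lo₂₁ - lo₁₁) * (s - s₁) / (s₂ - s₁))) *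
            (U - U₁) / (U₂ - U₁)) ≤
      max (max (hi₁₁ - lo₁₁) (hi₁₂ - lo₁₂) +
            (U₂ - U₁) *
              (max (A₁₁ - min ((lo₁₂ - lo₁₁) / (U₂ - U₁)) ((lo₂₂ - lo₂₁) / (U₂ - U₁))) 0 *
                max (max ((lo₁₂ - lo₁₁) / (U₂ - U₁)) ((lo₂₂ - lo₂₁) / (U₂ - U₁)) - B₁₂) 0) /
              (max (A₁₁ - min ((lo₁₂ - lo₁₁) / (U₂ - U₁)) ((lo₂₂ - lo₂₁) / (U₂ - U₁))) 0 +
                max (max ((lo₁₂ - lo₁₁) / (U₂ - U₁)) ((lo₂₂ - lo₂₁) / (U₂ - U₁)) - B₁₂) 0))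
          (max (hi₂₁ - lo₂₁) (hi₂₂ - lo₂₂) +
            (U₂ - U₁) *
              (max (A₂₁ - min ((lo₁₂ - lo₁₁) / (U₂ - U₁)) ((lo₂₂ - lo₂₁) / (U₂ - U₁))) 0 *
                max (max ((lo₁₂ - lo₁₁) / (U₂ - U₁)) ((lo₂₂ - lo₂₁) / (U₂ - U₁)) - B₂₂) 0) /
              (max (A₂₁ - min ((lo₁₂ - lo₁₁) / (U₂ - U₁)) ((lo₂₂ - lo₂₁) / (U₂ - U₁))) 0 +
                max (max ((lo₁₂ - lo₁₁) / (U₂ - U₁)) ((lo₂₂ - lo₂₁) / (U₂ - U₁)) - B₂₂) 0)) +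
        (s₂ - s₁) *
          (max (max (K₁₁ - (lo₂₁ - lo₁₁) / (s₂ - s₁)) (K₁₂ - (lo₂₂ - lo₁₂) / (s₂ - s₁))) 0 *
            max (max ((lo₂₁ - lo₁₁) / (s₂ - s₁) - J₂₁) ((lo₂₂ - lo₁₂) / (s₂ - s₁) - J₂₂)) 0) /
          (max (max (K₁₁ - (lo₂₁ - lo₁₁) / (s₂ - s₁)) (K₁₂ - (lo₂₂ - lo₁₂) / (s₂ - s₁))) 0 +
            max (max ((lo₂₁ - lo₁₁) / (s₂ - s₁) - J₂₁) ((lo₂₂ - lo₁₂) / (s₂ - s₁) - J₂₂)) 0) := by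
  obtain ⟨hσm, hσM⟩ := rowChords_secant_mem (lo₁₁ := lo₁₁) (lo₂₁ := lo₂₁) (lo₁₂ := lo₁₂) (lo₂₂ := lo₂₂)
    (U₁ := U₁) (U₂ := U₂) hs hs₁ hs₂
  have c₁ := min_tangents_sub_chord_le_bulge_of_slope_mem (P := hi₁₁ + K₁₁ * (s - s₁)) (Q := hi₁₂ + K₁₂ * (s - s₁))
    (A := A₁₁) (B := B₁₂) hUlt hU₁ hU₂ hσm hσM
  have c₂ := min_tangents_sub_chord_le_bulge_of_slope_mem (P := hi₂₁ - J₂₁ * (s₂ - s)) (Q := hi₂₂ - J₂₂ * (s₂ - s))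
    (A := A₂₁) (B := B₂₂) hUlt hU₁ hU₂ hσm hσM
  have g₁ := leftColumn_gaps_le (hi₁₁ := hi₁₁) (hi₁₂ := hi₁₂) (lo₁₁ := lo₁₁) (lo₂₁ := lo₂₁) (lo₁₂ := lo₁₂)
    (lo₂₂ := lo₂₂) (K₁₁ := K₁₁) (K₁₂ := K₁₂) (s₂ := s₂) hs₁
  have g₂ := rightColumn_gaps_le (hi₂₁ := hi₂₁) (hi₂₂ := hi₂₂) (lo₁₁ := lo₁₁) (lo₂₁ := lo₂₁) (lo₁₂ := lo₁₂)
    (lo₂₂ := lo₂₂) (J₂₁ := J₂₁) (J₂₂ := J₂₂) hs hs₂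
  have m₁ := min_le_left (min (hi₁₁ + K₁₁ * (s - s₁) + A₁₁ * (U - U₁)) (hi₁₂ + K₁₂ * (s - s₁) - B₁₂ * (U₂ - U)))
    (min (hi₂₁ - J₂₁ * (s₂ - s) + A₂₁ * (U - U₁)) (hi₂₂ - J₂₂ * (s₂ - s) - B₂₂ * (U₂ - U)))
  have m₂ := min_le_right (min (hi₁₁ + K₁₁ * (s - s₁) + A₁₁ * (U - U₁)) (hi₁₂ + K₁₂ * (s - s₁) - B₁₂ * (U₂ - U)))
    (min (hi₂₁ - J₂₁ * (s₂ - s) + A₂₁ * (U - U₁)) (hi₂₂ - J₂₂ * (s₂ - s) - B₂₂ * (U₂ - U)))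
  refine le_max_add_bulge_of_le_two_affine hs₁ hs₂ (P₁ := max (hi₁₁ - lo₁₁) (hi₁₂ - lo₁₂) +
      (U₂ - U₁) *
        (max (A₁₁ - min ((lo₁₂ - lo₁₁) / (U₂ - U₁)) ((lo₂₂ - lo₂₁) / (U₂ - U₁))) 0 *
          max (max ((lo₁₂ - lo₁₁) / (U₂ - U₁)) ((lo₂₂ - lo₂₁) / (U₂ - U₁)) - B₁₂) 0) /
        (max (A₁₁ - min ((lo₁₂ - lo₁₁) / (U₂ - U₁)) ((lo₂₂ - lo₂₁) / (U₂ - U₁))) 0 +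
          max (max ((lo₁₂ - lo₁₁) / (U₂ - U₁)) ((lo₂₂ - lo₂₁) / (U₂ - U₁)) - B₁₂) 0))
    (P₂ := max (hi₂₁ - lo₂₁) (hi₂₂ - lo₂₂) +
      (U₂ - U₁) *
        (max (A₂₁ - min ((lo₁₂ - lo₁₁) / (U₂ - U₁)) ((lo₂₂ - lo₂₁) / (U₂ - U₁))) 0 *
          max (max ((lo₁₂ - lo₁₁) / (U₂ - U₁)) ((lo₂₂ - lo₂₁) / (U₂ - U₁)) - B₂₂) 0) /
        (max (A₂₁ - min ((lo₁₂ - lo₁₁) / (U₂ - U₁)) ((lo₂₂ - lo₂₁) / (U₂ - U₁))) 0 +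
          max (max ((lo₁₂ - lo₁₁) / (U₂ - U₁)) ((lo₂₂ - lo₂₁) / (U₂ - U₁)) - B₂₂) 0)) ?_ ?_
  · have hx := mul_comm (s - s₁) (max (K₁₁ - (lo₂₁ - lo₁₁) / (s₂ - s₁)) (K₁₂ - (lo₂₂ - lo₁₂) / (s₂ - s₁)))
    linarith
  · have hx := mul_comm (s₂ - s) (max ((lo₂₁ - lo₁₁) / (s₂ - s₁) - J₂₁) ((lo₂₂ - lo₁₂) / (s₂ - s₁) - J₂₂))
    linarith

end NestedBulge

section Uniform

/-- **UNIFORM ORDER CEILING ON A `(t', U)` RECTANGLE from its four corners, grand-canonical words**: with the data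
of `dWaveOrderParameterTT'_rect_le_of_cornerWords`, for EVERY `(s,U) ∈ [s₁,s₂] × [U₁,U₂]`,
`m⋆(s,U,μ) ≤ (max(G₁ + w_U·H(A₁₁ − σ⁻, σ⁺ − B₁₂), G₂ + w_U·H(A₂₁ − σ⁻, σ⁺ − B₂₂)) + w_s·H(a₁, b₂))/(2h)` — second
order in both widths when the slope words are sharp. [cite: KomaTasaki1994, §1] -/
theorem dWaveOrderParameterTT'_rect_le_nestedBulge_of_cornerWords
    {s₁ s₂ U₁ U₂ μ h hi₁₁ hi₂₁ hi₁₂ hi₂₂ lo₁₁ lo₂₁ lo₁₂ lo₂₂ K₁₁ K₁₂ J₂₁ J₂₂ A₁₁ A₂₁ B₁₂ B₂₂ : ℝ}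
    (hh : 0 < h) (hs : s₁ < s₂) (hUlt : U₁ < U₂)
    (hhi₁₁ : dWaveSourceEnergyDensityTT' s₁ U₁ μ 0 ≤ hi₁₁) (hhi₂₁ : dWaveSourceEnergyDensityTT' s₂ U₁ μ 0 ≤ hi₂₁)
    (hhi₁₂ : dWaveSourceEnergyDensityTT' s₁ U₂ μ 0 ≤ hi₁₂) (hhi₂₂ : dWaveSourceEnergyDensityTT' s₂ U₂ μ 0 ≤ hi₂₂)
    (hlo₁₁ : lo₁₁ ≤ dWaveSourceEnergyDensityTT' s₁ U₁ μ h) (hlo₂₁ : lo₂₁ ≤ dWaveSourceEnergyDensityTT' s₂ U₁ μ h)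
    (hlo₁₂ : lo₁₂ ≤ dWaveSourceEnergyDensityTT' s₁ U₂ μ h) (hlo₂₂ : lo₂₂ ≤ dWaveSourceEnergyDensityTT' s₂ U₂ μ h)
    (h₁₁ : ∀ ω : InfVolFermionState 2,
      ω.IsMeanEnergyMinimiser (hubbardTTPrimeSourcedInteraction 1 s₁ U₁ μ dWaveFormFactor 0) 1 →
        ω.meanEnergy (hubbardTTPrimeFermionInteraction 0 1 0) 1 ≤ K₁₁ ∧
          ω.meanEnergy (hubbardTTPrimeFermionInteraction 0 0 1) 1 ≤ A₁₁)
    (h₁₂ : ∀ ω : InfVolFermionState 2,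
      ω.IsMeanEnergyMinimiser (hubbardTTPrimeSourcedInteraction 1 s₁ U₂ μ dWaveFormFactor 0) 1 →
        ω.meanEnergy (hubbardTTPrimeFermionInteraction 0 1 0) 1 ≤ K₁₂ ∧
          B₁₂ ≤ ω.meanEnergy (hubbardTTPrimeFermionInteraction 0 0 1) 1)
    (h₂₁ : ∀ ω : InfVolFermionState 2,
      ω.IsMeanEnergyMinimiser (hubbardTTPrimeSourcedInteraction 1 s₂ U₁ μ dWaveFormFactor 0) 1 →
        J₂₁ ≤ ω.meanEnergy (hubbardTTPrimeFermionInteraction 0 1 0) 1 ∧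
          ω.meanEnergy (hubbardTTPrimeFermionInteraction 0 0 1) 1 ≤ A₂₁)
    (h₂₂ : ∀ ω : InfVolFermionState 2,
      ω.IsMeanEnergyMinimiser (hubbardTTPrimeSourcedInteraction 1 s₂ U₂ μ dWaveFormFactor 0) 1 →
        J₂₂ ≤ ω.meanEnergy (hubbardTTPrimeFermionInteraction 0 1 0) 1 ∧
          B₂₂ ≤ ω.meanEnergy (hubbardTTPrimeFermionInteraction 0 0 1) 1)
    {s U : ℝ} (hs₁ : s₁ ≤ s) (hs₂ : s ≤ s₂) (hU₁ : U₁ ≤ U) (hU₂ : U ≤ U₂) :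
    dWaveOrderParameterTT' s U μ ≤
      (
      max (max (hi₁₁ - lo₁₁) (hi₁₂ - lo₁₂) +
            (U₂ - U₁) *
              (max (A₁₁ - min ((lo₁₂ - lo₁₁) / (U₂ - U₁)) ((lo₂₂ - lo₂₁) / (U₂ - U₁))) 0 *
                max (max ((lo₁₂ - lo₁₁) / (U₂ - U₁)) ((lo₂₂ - lo₂₁) / (U₂ - U₁)) - B₁₂) 0) /
              (max (A₁₁ - min ((lo₁₂ - lo₁₁) / (U₂ - U₁)) ((lo₂₂ - lo₂₁) / (U₂ - U₁))) 0 +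
                max (max ((lo₁₂ - lo₁₁) / (U₂ - U₁)) ((lo₂₂ - lo₂₁) / (U₂ - U₁)) - B₁₂) 0))
          (max (hi₂₁ - lo₂₁) (hi₂₂ - lo₂₂) +
            (U₂ - U₁) *
              (max (A₂₁ - min ((lo₁₂ - lo₁₁) / (U₂ - U₁)) ((lo₂₂ - lo₂₁) / (U₂ - U₁))) 0 *
                max (max ((lo₁₂ - lo₁₁) / (U₂ - U₁)) ((lo₂₂ - lo₂₁) / (U₂ - U₁)) - B₂₂) 0) /
              (max (A₂₁ - min ((lo₁₂ - lo₁₁) / (U₂ - U₁)) ((lo₂₂ - lo₂₁) / (U₂ - U₁))) 0 +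
                max (max ((lo₁₂ - lo₁₁) / (U₂ - U₁)) ((lo₂₂ - lo₂₁) / (U₂ - U₁)) - B₂₂) 0)) +
        (s₂ - s₁) *
          (max (max (K₁₁ - (lo₂₁ - lo₁₁) / (s₂ - s₁)) (K₁₂ - (lo₂₂ - lo₁₂) / (s₂ - s₁))) 0 *
            max (max ((lo₂₁ - lo₁₁) / (s₂ - s₁) - J₂₁) ((lo₂₂ - lo₁₂) / (s₂ - s₁) - J₂₂)) 0) /
          (max (max (K₁₁ - (lo₂₁ - lo₁₁) / (s₂ - s₁)) (K₁₂ - (lo₂₂ - lo₁₂) / (s₂ - s₁))) 0 +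
            max (max ((lo₂₁ - lo₁₁) / (s₂ - s₁) - J₂₁) ((lo₂₂ - lo₁₂) / (s₂ - s₁) - J₂₂)) 0)) / (2 * h) :=
  (dWaveOrderParameterTT'_rect_le_of_cornerWords hh hs hUlt hhi₁₁ hhi₂₁ hhi₁₂ hhi₂₂ hlo₁₁ hlo₂₁ hlo₁₂ hlo₂₂ h₁₁ h₁₂
    h₂₁ h₂₂ hs₁ hs₂ hU₁ hU₂).trans
    (div_le_div_of_nonneg_right (min_cornerPlanes_sub_bilinear_le_nestedBulge hs hUlt hs₁ hs₂ hU₁ hU₂) (by positivity))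

/-- **UNIFORM ORDER CEILING ON A `(t', U)` RECTANGLE, CANONICAL corner words** (gaps `gⱼᵢ = Rⱼᵢ − μn − loⱼᵢ`): for
every `(s,U)` in the rectangle, `m⋆(s,U,μ) ≤ (nested bulge)/(2h)`. [cite: KomaTasaki1994, §1] -/
theorem dWaveOrderParameterTT'_rect_le_nestedBulge_of_canonical_cornerWords {s₁ s₂ U₁ U₂ : ℝ} (hU₁0 : 0 ≤ U₁)
    (hs : s₁ < s₂) (hUlt : U₁ < U₂) {n : ℝ} (hn0 : 0 ≤ n) (hn2 : n < 2) {μ h : ℝ} (hh : 0 < h)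
    {R₁₁ R₂₁ R₁₂ R₂₂ lo₁₁ lo₂₁ lo₁₂ lo₂₂ K₁₁ K₁₂ J₂₁ J₂₂ A₁₁ A₂₁ B₁₂ B₂₂ : ℝ}
    (hR₁₁ : energyDensityTT' 1 s₁ U₁ n ≤ R₁₁) (hR₂₁ : energyDensityTT' 1 s₂ U₁ n ≤ R₂₁)
    (hR₁₂ : energyDensityTT' 1 s₁ U₂ n ≤ R₁₂) (hR₂₂ : energyDensityTT' 1 s₂ U₂ n ≤ R₂₂)
    (h₁₁ : ∀ (ω : InfVolFermionState 2) (Ls : ℕ → ℕ) (ψ : ∀ L, Fock (Orb (FermionTorus 2 L))),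
      Tendsto Ls atTop atTop →
      (∀ j, IsGroundStateInSector (hubbardTorusTT' (Ls j) 1 s₁ U₁) (rectN n (Ls j)) 0 (ψ (Ls j))) →
      (∀ j, star (ψ (Ls j)) ⬝ᵥ ψ (Ls j) = 1) → ω.IsTorusLimitOf ψ Ls →
      ω.meanEnergy (hubbardTTPrimeFermionInteraction 0 1 0) 1 ≤ K₁₁ ∧
        (ω.expect ({0} : Finset (Site 2))
          (nAt 0 (Finset.mem_singleton_self 0) 0 * nAt 0 (Finset.mem_singleton_self 0) 1)).re ≤ A₁₁)
    (h₁₂ : ∀ (ω : InfVolFermionState 2) (Ls : ℕ → ℕ) (ψ : ∀ L, Fock (Orb (FermionTorus 2 L))),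
      Tendsto Ls atTop atTop →
      (∀ j, IsGroundStateInSector (hubbardTorusTT' (Ls j) 1 s₁ U₂) (rectN n (Ls j)) 0 (ψ (Ls j))) →
      (∀ j, star (ψ (Ls j)) ⬝ᵥ ψ (Ls j) = 1) → ω.IsTorusLimitOf ψ Ls →
      ω.meanEnergy (hubbardTTPrimeFermionInteraction 0 1 0) 1 ≤ K₁₂ ∧
        B₁₂ ≤ (ω.expect ({0} : Finset (Site 2))
          (nAt 0 (Finset.mem_singleton_self 0) 0 * nAt 0 (Finset.mem_singleton_self 0) 1)).re)
    (h₂₁ : ∀ (ω : InfVolFermionState 2) (Ls : ℕ → ℕ) (ψ : ∀ L, Fock (Orb (FermionTorus 2 L))),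
      Tendsto Ls atTop atTop →
      (∀ j, IsGroundStateInSector (hubbardTorusTT' (Ls j) 1 s₂ U₁) (rectN n (Ls j)) 0 (ψ (Ls j))) →
      (∀ j, star (ψ (Ls j)) ⬝ᵥ ψ (Ls j) = 1) → ω.IsTorusLimitOf ψ Ls →
      J₂₁ ≤ ω.meanEnergy (hubbardTTPrimeFermionInteraction 0 1 0) 1 ∧
        (ω.expect ({0} : Finset (Site 2))
          (nAt 0 (Finset.mem_singleton_self 0) 0 * nAt 0 (Finset.mem_singleton_self 0) 1)).re ≤ A₂₁)
    (h₂₂ : ∀ (ω : InfVolFermionState 2) (Ls : ℕ → ℕ) (ψ : ∀ L, Fock (Orb (FermionTorus 2 L))),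
      Tendsto Ls atTop atTop →
      (∀ j, IsGroundStateInSector (hubbardTorusTT' (Ls j) 1 s₂ U₂) (rectN n (Ls j)) 0 (ψ (Ls j))) →
      (∀ j, star (ψ (Ls j)) ⬝ᵥ ψ (Ls j) = 1) → ω.IsTorusLimitOf ψ Ls →
      J₂₂ ≤ ω.meanEnergy (hubbardTTPrimeFermionInteraction 0 1 0) 1 ∧
        B₂₂ ≤ (ω.expect ({0} : Finset (Site 2))
          (nAt 0 (Finset.mem_singleton_self 0) 0 * nAt 0 (Finset.mem_singleton_self 0) 1)).re)
    (hlo₁₁ : lo₁₁ ≤ dWaveSourceEnergyDensityTT' s₁ U₁ μ h) (hlo₂₁ : lo₂₁ ≤ dWaveSourceEnergyDensityTT' s₂ U₁ μ h)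
    (hlo₁₂ : lo₁₂ ≤ dWaveSourceEnergyDensityTT' s₁ U₂ μ h) (hlo₂₂ : lo₂₂ ≤ dWaveSourceEnergyDensityTT' s₂ U₂ μ h)
    {s U : ℝ} (hs₁ : s₁ ≤ s) (hs₂ : s ≤ s₂) (hU₁ : U₁ ≤ U) (hU₂ : U ≤ U₂) :
    dWaveOrderParameterTT' s U μ ≤
      (
      max (max (R₁₁ - μ * n - lo₁₁) (R₁₂ - μ * n - lo₁₂) +
            (U₂ - U₁) *
              (max (A₁₁ - min ((lo₁₂ - lo₁₁) / (U₂ - U₁)) ((lo₂₂ - lo₂₁) / (U₂ - U₁))) 0 *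
                max (max ((lo₁₂ - lo₁₁) / (U₂ - U₁)) ((lo₂₂ - lo₂₁) / (U₂ - U₁)) - B₁₂) 0) /
              (max (A₁₁ - min ((lo₁₂ - lo₁₁) / (U₂ - U₁)) ((lo₂₂ - lo₂₁) / (U₂ - U₁))) 0 +
                max (max ((lo₁₂ - lo₁₁) / (U₂ - U₁)) ((lo₂₂ - lo₂₁) / (U₂ - U₁)) - B₁₂) 0))
          (max (R₂₁ - μ * n - lo₂₁) (R₂₂ - μ * n - lo₂₂) +
            (U₂ - U₁) *
              (max (A₂₁ - min ((lo₁₂ - lo₁₁) / (U₂ - U₁)) ((lo₂₂ - lo₂₁) / (U₂ - U₁))) 0 *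
                max (max ((lo₁₂ - lo₁₁) / (U₂ - U₁)) ((lo₂₂ - lo₂₁) / (U₂ - U₁)) - B₂₂) 0) /
              (max (A₂₁ - min ((lo₁₂ - lo₁₁) / (U₂ - U₁)) ((lo₂₂ - lo₂₁) / (U₂ - U₁))) 0 +
                max (max ((lo₁₂ - lo₁₁) / (U₂ - U₁)) ((lo₂₂ - lo₂₁) / (U₂ - U₁)) - B₂₂) 0)) +
        (s₂ - s₁) *
          (max (max (K₁₁ - (lo₂₁ - lo₁₁) / (s₂ - s₁)) (K₁₂ - (lo₂₂ - lo₁₂) / (s₂ - s₁))) 0 *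
            max (max ((lo₂₁ - lo₁₁) / (s₂ - s₁) - J₂₁) ((lo₂₂ - lo₁₂) / (s₂ - s₁) - J₂₂)) 0) /
          (max (max (K₁₁ - (lo₂₁ - lo₁₁) / (s₂ - s₁)) (K₁₂ - (lo₂₂ - lo₁₂) / (s₂ - s₁))) 0 +
            max (max ((lo₂₁ - lo₁₁) / (s₂ - s₁) - J₂₁) ((lo₂₂ - lo₁₂) / (s₂ - s₁) - J₂₂)) 0)) / (2 * h) := by
  refine (dWaveOrderParameterTT'_rect_le_of_canonical_cornerWords hU₁0 hs hUlt hn0 hn2 hh hR₁₁ hR₂₁ hR₁₂ hR₂₂ h₁₁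
    h₁₂ h₂₁ h₂₂ hlo₁₁ hlo₂₁ hlo₁₂ hlo₂₂ hs₁ hs₂ hU₁ hU₂).trans (div_le_div_of_nonneg_right ?_ (by positivity))
  have hb := min_cornerPlanes_sub_bilinear_le_nestedBulge (hi₁₁ := R₁₁ - μ * n) (hi₂₁ := R₂₁ - μ * n)
    (hi₁₂ := R₁₂ - μ * n) (hi₂₂ := R₂₂ - μ * n) (lo₁₁ := lo₁₁) (lo₂₁ := lo₂₁) (lo₁₂ := lo₁₂) (lo₂₂ := lo₂₂)
    (K₁₁ := K₁₁) (K₁₂ := K₁₂) (J₂₁ := J₂₁) (J₂₂ := J₂₂) (A₁₁ := A₁₁) (A₂₁ := A₂₁) (B₁₂ := B₁₂) (B₂₂ := B₂₂)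
    hs hUlt hs₁ hs₂ hU₁ hU₂
  have e : min (min (R₁₁ + K₁₁ * (s - s₁) + A₁₁ * (U - U₁)) (R₁₂ + K₁₂ * (s - s₁) - B₁₂ * (U₂ - U)))
        (min (R₂₁ - J₂₁ * (s₂ - s) + A₂₁ * (U - U₁)) (R₂₂ - J₂₂ * (s₂ - s) - B₂₂ * (U₂ - U))) - μ * n =
      min (min (R₁₁ - μ * n + K₁₁ * (s - s₁) + A₁₁ * (U - U₁)) (R₁₂ - μ * n + K₁₂ * (s - s₁) - B₁₂ * (U₂ - U)))
        (min (R₂₁ - μ * n - J₂₁ * (s₂ - s) + A₂₁ * (U - U₁)) (R₂₂ - μ * n - J₂₂ * (s₂ - s) - B₂₂ * (U₂ - U))) := by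
    rw [← min_sub_sub_right, ← min_sub_sub_right, ← min_sub_sub_right]
    congr 1 <;> congr 1 <;> ring
  linarith [hb, e]

/-- **ABSENT(`< m₀`) ON A WHOLE `(t', U)` RECTANGLE, canonical corner words**: if the nested bulge (gaps
`Rⱼᵢ − μn − loⱼᵢ`) is `< 2h·m₀` then `m⋆(s,U,μ) < m₀` for every `(s,U)` in the rectangle. [cite: KomaTasaki1994, §1] -/
theorem dWaveOrderParameterTT'_lt_on_rect_of_canonical_cornerWords {s₁ s₂ U₁ U₂ : ℝ} (hU₁0 : 0 ≤ U₁)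
    (hs : s₁ < s₂) (hUlt : U₁ < U₂) {n : ℝ} (hn0 : 0 ≤ n) (hn2 : n < 2) {μ h : ℝ} (hh : 0 < h)
    {R₁₁ R₂₁ R₁₂ R₂₂ lo₁₁ lo₂₁ lo₁₂ lo₂₂ K₁₁ K₁₂ J₂₁ J₂₂ A₁₁ A₂₁ B₁₂ B₂₂ m₀ : ℝ}
    (hR₁₁ : energyDensityTT' 1 s₁ U₁ n ≤ R₁₁) (hR₂₁ : energyDensityTT' 1 s₂ U₁ n ≤ R₂₁)
    (hR₁₂ : energyDensityTT' 1 s₁ U₂ n ≤ R₁₂) (hR₂₂ : energyDensityTT' 1 s₂ U₂ n ≤ R₂₂)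
    (h₁₁ : ∀ (ω : InfVolFermionState 2) (Ls : ℕ → ℕ) (ψ : ∀ L, Fock (Orb (FermionTorus 2 L))),
      Tendsto Ls atTop atTop →
      (∀ j, IsGroundStateInSector (hubbardTorusTT' (Ls j) 1 s₁ U₁) (rectN n (Ls j)) 0 (ψ (Ls j))) →
      (∀ j, star (ψ (Ls j)) ⬝ᵥ ψ (Ls j) = 1) → ω.IsTorusLimitOf ψ Ls →
      ω.meanEnergy (hubbardTTPrimeFermionInteraction 0 1 0) 1 ≤ K₁₁ ∧
        (ω.expect ({0} : Finset (Site 2))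
          (nAt 0 (Finset.mem_singleton_self 0) 0 * nAt 0 (Finset.mem_singleton_self 0) 1)).re ≤ A₁₁)
    (h₁₂ : ∀ (ω : InfVolFermionState 2) (Ls : ℕ → ℕ) (ψ : ∀ L, Fock (Orb (FermionTorus 2 L))),
      Tendsto Ls atTop atTop →
      (∀ j, IsGroundStateInSector (hubbardTorusTT' (Ls j) 1 s₁ U₂) (rectN n (Ls j)) 0 (ψ (Ls j))) →
      (∀ j, star (ψ (Ls j)) ⬝ᵥ ψ (Ls j) = 1) → ω.IsTorusLimitOf ψ Ls →
      ω.meanEnergy (hubbardTTPrimeFermionInteraction 0 1 0) 1 ≤ K₁₂ ∧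
        B₁₂ ≤ (ω.expect ({0} : Finset (Site 2))
          (nAt 0 (Finset.mem_singleton_self 0) 0 * nAt 0 (Finset.mem_singleton_self 0) 1)).re)
    (h₂₁ : ∀ (ω : InfVolFermionState 2) (Ls : ℕ → ℕ) (ψ : ∀ L, Fock (Orb (FermionTorus 2 L))),
      Tendsto Ls atTop atTop →
      (∀ j, IsGroundStateInSector (hubbardTorusTT' (Ls j) 1 s₂ U₁) (rectN n (Ls j)) 0 (ψ (Ls j))) →
      (∀ j, star (ψ (Ls j)) ⬝ᵥ ψ (Ls j) = 1) → ω.IsTorusLimitOf ψ Ls →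
      J₂₁ ≤ ω.meanEnergy (hubbardTTPrimeFermionInteraction 0 1 0) 1 ∧
        (ω.expect ({0} : Finset (Site 2))
          (nAt 0 (Finset.mem_singleton_self 0) 0 * nAt 0 (Finset.mem_singleton_self 0) 1)).re ≤ A₂₁)
    (h₂₂ : ∀ (ω : InfVolFermionState 2) (Ls : ℕ → ℕ) (ψ : ∀ L, Fock (Orb (FermionTorus 2 L))),
      Tendsto Ls atTop atTop →
      (∀ j, IsGroundStateInSector (hubbardTorusTT' (Ls j) 1 s₂ U₂) (rectN n (Ls j)) 0 (ψ (Ls j))) →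
      (∀ j, star (ψ (Ls j)) ⬝ᵥ ψ (Ls j) = 1) → ω.IsTorusLimitOf ψ Ls →
      J₂₂ ≤ ω.meanEnergy (hubbardTTPrimeFermionInteraction 0 1 0) 1 ∧
        B₂₂ ≤ (ω.expect ({0} : Finset (Site 2))
          (nAt 0 (Finset.mem_singleton_self 0) 0 * nAt 0 (Finset.mem_singleton_self 0) 1)).re)
    (hlo₁₁ : lo₁₁ ≤ dWaveSourceEnergyDensityTT' s₁ U₁ μ h) (hlo₂₁ : lo₂₁ ≤ dWaveSourceEnergyDensityTT' s₂ U₁ μ h)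
    (hlo₁₂ : lo₁₂ ≤ dWaveSourceEnergyDensityTT' s₁ U₂ μ h) (hlo₂₂ : lo₂₂ ≤ dWaveSourceEnergyDensityTT' s₂ U₂ μ h)
    (habs :
      max (max (R₁₁ - μ * n - lo₁₁) (R₁₂ - μ * n - lo₁₂) +
            (U₂ - U₁) *
              (max (A₁₁ - min ((lo₁₂ - lo₁₁) / (U₂ - U₁)) ((lo₂₂ - lo₂₁) / (U₂ - U₁))) 0 *
                max (max ((lo₁₂ - lo₁₁) / (U₂ - U₁)) ((lo₂₂ - lo₂₁) / (U₂ - U₁)) - B₁₂) 0) /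
              (max (A₁₁ - min ((lo₁₂ - lo₁₁) / (U₂ - U₁)) ((lo₂₂ - lo₂₁) / (U₂ - U₁))) 0 +
                max (max ((lo₁₂ - lo₁₁) / (U₂ - U₁)) ((lo₂₂ - lo₂₁) / (U₂ - U₁)) - B₁₂) 0))
          (max (R₂₁ - μ * n - lo₂₁) (R₂₂ - μ * n - lo₂₂) +
            (U₂ - U₁) *
              (max (A₂₁ - min ((lo₁₂ - lo₁₁) / (U₂ - U₁)) ((lo₂₂ - lo₂₁) / (U₂ - U₁))) 0 *
                max (max ((lo₁₂ - lo₁₁) / (U₂ - U₁)) ((lo₂₂ - lo₂₁) / (U₂ - U₁)) - B₂₂) 0) /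
              (max (A₂₁ - min ((lo₁₂ - lo₁₁) / (U₂ - U₁)) ((lo₂₂ - lo₂₁) / (U₂ - U₁))) 0 +
                max (max ((lo₁₂ - lo₁₁) / (U₂ - U₁)) ((lo₂₂ - lo₂₁) / (U₂ - U₁)) - B₂₂) 0)) +
        (s₂ - s₁) *
          (max (max (K₁₁ - (lo₂₁ - lo₁₁) / (s₂ - s₁)) (K₁₂ - (lo₂₂ - lo₁₂) / (s₂ - s₁))) 0 *
            max (max ((lo₂₁ - lo₁₁) / (s₂ - s₁) - J₂₁) ((lo₂₂ - lo₁₂) / (s₂ - s₁) - J₂₂)) 0) /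
          (max (max (K₁₁ - (lo₂₁ - lo₁₁) / (s₂ - s₁)) (K₁₂ - (lo₂₂ - lo₁₂) / (s₂ - s₁))) 0 +
            max (max ((lo₂₁ - lo₁₁) / (s₂ - s₁) - J₂₁) ((lo₂₂ - lo₁₂) / (s₂ - s₁) - J₂₂)) 0) < 2 * h * m₀)
    {s U : ℝ} (hs₁ : s₁ ≤ s) (hs₂ : s ≤ s₂) (hU₁ : U₁ ≤ U) (hU₂ : U ≤ U₂) :
    dWaveOrderParameterTT' s U μ < m₀ := by
  refine (dWaveOrderParameterTT'_rect_le_nestedBulge_of_canonical_cornerWords hU₁0 hs hUlt hn0 hn2 hh hR₁₁ hR₂₁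
    hR₁₂ hR₂₂ h₁₁ h₁₂ h₂₁ h₂₂ hlo₁₁ hlo₂₁ hlo₁₂ hlo₂₂ hs₁ hs₂ hU₁ hU₂).trans_lt ?_
  rw [div_lt_iff₀ (by positivity)]
  linarith

/-- **PAIR-AMPLITUDE CEILING ON A `(t', U) × [μ₁,μ₂]` CELL, uniform nested-bulge form, translation-invariant ground
states of object M** (canonical corner words; floors `loⱼᵢ` certified at `μ₂`; gaps `Rⱼᵢ − μ₁n − loⱼᵢ`): every
translation-invariant mean-energy minimiser `σ` of `H_M − μ'N` at `(1, t', t'', U, μ')`, `(t',U)` in the rectangle,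
`μ' ∈ [μ₁,μ₂]`, has `e_P(σ) ≤ (nested bulge + (32/π²)|t''|)/h`. [cite: BratteliKishimotoRobinson1978, Thm. 2] -/
theorem meanEnergy_pairSource_le_nestedBulge_of_rect_mu_cell_of_minimiser {s₁ s₂ U₁ U₂ : ℝ} (hU₁0 : 0 ≤ U₁)
    (hs : s₁ < s₂) (hUlt : U₁ < U₂) {n : ℝ} (hn0 : 0 ≤ n) (hn2 : n < 2) {μ₁ μ₂ h : ℝ} (hh : 0 < h)
    {R₁₁ R₂₁ R₁₂ R₂₂ lo₁₁ lo₂₁ lo₁₂ lo₂₂ K₁₁ K₁₂ J₂₁ J₂₂ A₁₁ A₂₁ B₁₂ B₂₂ : ℝ}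
    (hR₁₁ : energyDensityTT' 1 s₁ U₁ n ≤ R₁₁) (hR₂₁ : energyDensityTT' 1 s₂ U₁ n ≤ R₂₁)
    (hR₁₂ : energyDensityTT' 1 s₁ U₂ n ≤ R₁₂) (hR₂₂ : energyDensityTT' 1 s₂ U₂ n ≤ R₂₂)
    (h₁₁ : ∀ (ω : InfVolFermionState 2) (Ls : ℕ → ℕ) (ψ : ∀ L, Fock (Orb (FermionTorus 2 L))),
      Tendsto Ls atTop atTop →
      (∀ j, IsGroundStateInSector (hubbardTorusTT' (Ls j) 1 s₁ U₁) (rectN n (Ls j)) 0 (ψ (Ls j))) →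
      (∀ j, star (ψ (Ls j)) ⬝ᵥ ψ (Ls j) = 1) → ω.IsTorusLimitOf ψ Ls →
      ω.meanEnergy (hubbardTTPrimeFermionInteraction 0 1 0) 1 ≤ K₁₁ ∧
        (ω.expect ({0} : Finset (Site 2))
          (nAt 0 (Finset.mem_singleton_self 0) 0 * nAt 0 (Finset.mem_singleton_self 0) 1)).re ≤ A₁₁)
    (h₁₂ : ∀ (ω : InfVolFermionState 2) (Ls : ℕ → ℕ) (ψ : ∀ L, Fock (Orb (FermionTorus 2 L))),
      Tendsto Ls atTop atTop →
      (∀ j, IsGroundStateInSector (hubbardTorusTT' (Ls j) 1 s₁ U₂) (rectN n (Ls j)) 0 (ψ (Ls j))) →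
      (∀ j, star (ψ (Ls j)) ⬝ᵥ ψ (Ls j) = 1) → ω.IsTorusLimitOf ψ Ls →
      ω.meanEnergy (hubbardTTPrimeFermionInteraction 0 1 0) 1 ≤ K₁₂ ∧
        B₁₂ ≤ (ω.expect ({0} : Finset (Site 2))
          (nAt 0 (Finset.mem_singleton_self 0) 0 * nAt 0 (Finset.mem_singleton_self 0) 1)).re)
    (h₂₁ : ∀ (ω : InfVolFermionState 2) (Ls : ℕ → ℕ) (ψ : ∀ L, Fock (Orb (FermionTorus 2 L))),
      Tendsto Ls atTop atTop →
      (∀ j, IsGroundStateInSector (hubbardTorusTT' (Ls j) 1 s₂ U₁) (rectN n (Ls j)) 0 (ψ (Ls j))) →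
      (∀ j, star (ψ (Ls j)) ⬝ᵥ ψ (Ls j) = 1) → ω.IsTorusLimitOf ψ Ls →
      J₂₁ ≤ ω.meanEnergy (hubbardTTPrimeFermionInteraction 0 1 0) 1 ∧
        (ω.expect ({0} : Finset (Site 2))
          (nAt 0 (Finset.mem_singleton_self 0) 0 * nAt 0 (Finset.mem_singleton_self 0) 1)).re ≤ A₂₁)
    (h₂₂ : ∀ (ω : InfVolFermionState 2) (Ls : ℕ → ℕ) (ψ : ∀ L, Fock (Orb (FermionTorus 2 L))),
      Tendsto Ls atTop atTop →
      (∀ j, IsGroundStateInSector (hubbardTorusTT' (Ls j) 1 s₂ U₂) (rectN n (Ls j)) 0 (ψ (Ls j))) →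
      (∀ j, star (ψ (Ls j)) ⬝ᵥ ψ (Ls j) = 1) → ω.IsTorusLimitOf ψ Ls →
      J₂₂ ≤ ω.meanEnergy (hubbardTTPrimeFermionInteraction 0 1 0) 1 ∧
        B₂₂ ≤ (ω.expect ({0} : Finset (Site 2))
          (nAt 0 (Finset.mem_singleton_self 0) 0 * nAt 0 (Finset.mem_singleton_self 0) 1)).re)
    (hlo₁₁ : lo₁₁ ≤ dWaveSourceEnergyDensityTT' s₁ U₁ μ₂ h) (hlo₂₁ : lo₂₁ ≤ dWaveSourceEnergyDensityTT' s₂ U₁ μ₂ h)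
    (hlo₁₂ : lo₁₂ ≤ dWaveSourceEnergyDensityTT' s₁ U₂ μ₂ h) (hlo₂₂ : lo₂₂ ≤ dWaveSourceEnergyDensityTT' s₂ U₂ μ₂ h)
    {t' U μ' : ℝ} (hs₁ : s₁ ≤ t') (hs₂ : t' ≤ s₂) (hU₁ : U₁ ≤ U) (hU₂ : U ≤ U₂) (hμ₁ : μ₁ ≤ μ') (hμ₂ : μ' ≤ μ₂)
    (t'' : ℝ) {σ : InfVolFermionState 2}
    (hmin : σ.IsMeanEnergyMinimiser (hubbardTT'T''SourcedInteraction 1 t' t'' U μ' dWaveFormFactor 0) 2) :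
    σ.meanEnergy (pairSourceInteraction dWaveFormFactor) 1 ≤
      (
      max (max (R₁₁ - μ₁ * n - lo₁₁) (R₁₂ - μ₁ * n - lo₁₂) +
            (U₂ - U₁) *
              (max (A₁₁ - min ((lo₁₂ - lo₁₁) / (U₂ - U₁)) ((lo₂₂ - lo₂₁) / (U₂ - U₁))) 0 *
                max (max ((lo₁₂ - lo₁₁) / (U₂ - U₁)) ((lo₂₂ - lo₂₁) / (U₂ - U₁)) - B₁₂) 0) /
              (max (A₁₁ - min ((lo₁₂ - lo₁₁) / (U₂ - U₁)) ((lo₂₂ - lo₂₁) / (U₂ - U₁))) 0 +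
                max (max ((lo₁₂ - lo₁₁) / (U₂ - U₁)) ((lo₂₂ - lo₂₁) / (U₂ - U₁)) - B₁₂) 0))
          (max (R₂₁ - μ₁ * n - lo₂₁) (R₂₂ - μ₁ * n - lo₂₂) +
            (U₂ - U₁) *
              (max (A₂₁ - min ((lo₁₂ - lo₁₁) / (U₂ - U₁)) ((lo₂₂ - lo₂₁) / (U₂ - U₁))) 0 *
                max (max ((lo₁₂ - lo₁₁) / (U₂ - U₁)) ((lo₂₂ - lo₂₁) / (U₂ - U₁)) - B₂₂) 0) /
              (max (A₂₁ - min ((lo₁₂ - lo₁₁) / (U₂ - U₁)) ((lo₂₂ - lo₂₁) / (U₂ - U₁))) 0 +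
                max (max ((lo₁₂ - lo₁₁) / (U₂ - U₁)) ((lo₂₂ - lo₂₁) / (U₂ - U₁)) - B₂₂) 0)) +
        (s₂ - s₁) *
          (max (max (K₁₁ - (lo₂₁ - lo₁₁) / (s₂ - s₁)) (K₁₂ - (lo₂₂ - lo₁₂) / (s₂ - s₁))) 0 *
            max (max ((lo₂₁ - lo₁₁) / (s₂ - s₁) - J₂₁) ((lo₂₂ - lo₁₂) / (s₂ - s₁) - J₂₂)) 0) /
          (max (max (K₁₁ - (lo₂₁ - lo₁₁) / (s₂ - s₁)) (K₁₂ - (lo₂₂ - lo₁₂) / (s₂ - s₁))) 0 +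
            max (max ((lo₂₁ - lo₁₁) / (s₂ - s₁) - J₂₁) ((lo₂₂ - lo₁₂) / (s₂ - s₁) - J₂₂)) 0) +
        32 / Real.pi ^ 2 * |t''|) / h := by
  have hk := meanEnergy_pairSource_le_of_rect_mu_cell_canonical_cornerWords (ε := 0) hU₁0 hs hUlt hn0 hn2 hh hR₁₁
    hR₂₁ hR₁₂ hR₂₂ h₁₁ h₁₂ h₂₁ h₂₂ hlo₁₁ hlo₂₁ hlo₁₂ hlo₂₂ hs₁ hs₂ hU₁ hU₂ hμ₁ hμ₂ t'' hmin.1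
    (by rw [add_zero]; exact hmin.meanEnergy_eq.le)
  rw [add_zero] at hk
  refine hk.trans (div_le_div_of_nonneg_right ?_ hh.le)
  have hb := min_cornerPlanes_sub_bilinear_le_nestedBulge (hi₁₁ := R₁₁ - μ₁ * n) (hi₂₁ := R₂₁ - μ₁ * n)
    (hi₁₂ := R₁₂ - μ₁ * n) (hi₂₂ := R₂₂ - μ₁ * n) (lo₁₁ := lo₁₁) (lo₂₁ := lo₂₁) (lo₁₂ := lo₁₂) (lo₂₂ := lo₂₂)
    (K₁₁ := K₁₁) (K₁₂ := K₁₂) (J₂₁ := J₂₁) (J₂₂ := J₂₂) (A₁₁ := A₁₁) (A₂₁ := A₂₁) (B₁₂ := B₁₂) (B₂₂ := B₂₂)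
    hs hUlt hs₁ hs₂ hU₁ hU₂
  have e : min (min (R₁₁ + K₁₁ * (t' - s₁) + A₁₁ * (U - U₁)) (R₁₂ + K₁₂ * (t' - s₁) - B₁₂ * (U₂ - U)))
        (min (R₂₁ - J₂₁ * (s₂ - t') + A₂₁ * (U - U₁)) (R₂₂ - J₂₂ * (s₂ - t') - B₂₂ * (U₂ - U))) - μ₁ * n =
      min (min (R₁₁ - μ₁ * n + K₁₁ * (t' - s₁) + A₁₁ * (U - U₁)) (R₁₂ - μ₁ * n + K₁₂ * (t' - s₁) - B₁₂ * (U₂ - U)))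
        (min (R₂₁ - μ₁ * n - J₂₁ * (s₂ - t') + A₂₁ * (U - U₁))
          (R₂₂ - μ₁ * n - J₂₂ * (s₂ - t') - B₂₂ * (U₂ - U))) := by
    rw [← min_sub_sub_right, ← min_sub_sub_right, ← min_sub_sub_right]
    congr 1 <;> congr 1 <;> ring
  linarith [hb, e]

/-- **ABSENT(`< m₀`) FOR OBJECT M ON A WHOLE `(t', U) × [μ₁,μ₂]` CELL** (canonical corner words): if
`nested bulge + (32/π²)|t''| < h·m₀` then no translation-invariant ground state of object M at `(1, t', t'', U, μ')`
with `(t',U)` in the rectangle and `μ' ∈ [μ₁,μ₂]` has `d`-wave pair amplitude `≥ m₀`. [cite: KomaTasaki1994, §1] -/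
theorem meanEnergy_pairSource_lt_on_rect_mu_cell_of_minimiser {s₁ s₂ U₁ U₂ : ℝ} (hU₁0 : 0 ≤ U₁)
    (hs : s₁ < s₂) (hUlt : U₁ < U₂) {n : ℝ} (hn0 : 0 ≤ n) (hn2 : n < 2) {μ₁ μ₂ h : ℝ} (hh : 0 < h)
    {R₁₁ R₂₁ R₁₂ R₂₂ lo₁₁ lo₂₁ lo₁₂ lo₂₂ K₁₁ K₁₂ J₂₁ J₂₂ A₁₁ A₂₁ B₁₂ B₂₂ m₀ : ℝ}
    (hR₁₁ : energyDensityTT' 1 s₁ U₁ n ≤ R₁₁) (hR₂₁ : energyDensityTT' 1 s₂ U₁ n ≤ R₂₁)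
    (hR₁₂ : energyDensityTT' 1 s₁ U₂ n ≤ R₁₂) (hR₂₂ : energyDensityTT' 1 s₂ U₂ n ≤ R₂₂)
    (h₁₁ : ∀ (ω : InfVolFermionState 2) (Ls : ℕ → ℕ) (ψ : ∀ L, Fock (Orb (FermionTorus 2 L))),
      Tendsto Ls atTop atTop →
      (∀ j, IsGroundStateInSector (hubbardTorusTT' (Ls j) 1 s₁ U₁) (rectN n (Ls j)) 0 (ψ (Ls j))) →
      (∀ j, star (ψ (Ls j)) ⬝ᵥ ψ (Ls j) = 1) → ω.IsTorusLimitOf ψ Ls →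
      ω.meanEnergy (hubbardTTPrimeFermionInteraction 0 1 0) 1 ≤ K₁₁ ∧
        (ω.expect ({0} : Finset (Site 2))
          (nAt 0 (Finset.mem_singleton_self 0) 0 * nAt 0 (Finset.mem_singleton_self 0) 1)).re ≤ A₁₁)
    (h₁₂ : ∀ (ω : InfVolFermionState 2) (Ls : ℕ → ℕ) (ψ : ∀ L, Fock (Orb (FermionTorus 2 L))),
      Tendsto Ls atTop atTop →
      (∀ j, IsGroundStateInSector (hubbardTorusTT' (Ls j) 1 s₁ U₂) (rectN n (Ls j)) 0 (ψ (Ls j))) →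
      (∀ j, star (ψ (Ls j)) ⬝ᵥ ψ (Ls j) = 1) → ω.IsTorusLimitOf ψ Ls →
      ω.meanEnergy (hubbardTTPrimeFermionInteraction 0 1 0) 1 ≤ K₁₂ ∧
        B₁₂ ≤ (ω.expect ({0} : Finset (Site 2))
          (nAt 0 (Finset.mem_singleton_self 0) 0 * nAt 0 (Finset.mem_singleton_self 0) 1)).re)
    (h₂₁ : ∀ (ω : InfVolFermionState 2) (Ls : ℕ → ℕ) (ψ : ∀ L, Fock (Orb (FermionTorus 2 L))),
      Tendsto Ls atTop atTop →
      (∀ j, IsGroundStateInSector (hubbardTorusTT' (Ls j) 1 s₂ U₁) (rectN n (Ls j)) 0 (ψ (Ls j))) →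
      (∀ j, star (ψ (Ls j)) ⬝ᵥ ψ (Ls j) = 1) → ω.IsTorusLimitOf ψ Ls →
      J₂₁ ≤ ω.meanEnergy (hubbardTTPrimeFermionInteraction 0 1 0) 1 ∧
        (ω.expect ({0} : Finset (Site 2))
          (nAt 0 (Finset.mem_singleton_self 0) 0 * nAt 0 (Finset.mem_singleton_self 0) 1)).re ≤ A₂₁)
    (h₂₂ : ∀ (ω : InfVolFermionState 2) (Ls : ℕ → ℕ) (ψ : ∀ L, Fock (Orb (FermionTorus 2 L))),
      Tendsto Ls atTop atTop →
      (∀ j, IsGroundStateInSector (hubbardTorusTT' (Ls j) 1 s₂ U₂) (rectN n (Ls j)) 0 (ψ (Ls j))) →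
      (∀ j, star (ψ (Ls j)) ⬝ᵥ ψ (Ls j) = 1) → ω.IsTorusLimitOf ψ Ls →
      J₂₂ ≤ ω.meanEnergy (hubbardTTPrimeFermionInteraction 0 1 0) 1 ∧
        B₂₂ ≤ (ω.expect ({0} : Finset (Site 2))
          (nAt 0 (Finset.mem_singleton_self 0) 0 * nAt 0 (Finset.mem_singleton_self 0) 1)).re)
    (hlo₁₁ : lo₁₁ ≤ dWaveSourceEnergyDensityTT' s₁ U₁ μ₂ h) (hlo₂₁ : lo₂₁ ≤ dWaveSourceEnergyDensityTT' s₂ U₁ μ₂ h)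
    (hlo₁₂ : lo₁₂ ≤ dWaveSourceEnergyDensityTT' s₁ U₂ μ₂ h) (hlo₂₂ : lo₂₂ ≤ dWaveSourceEnergyDensityTT' s₂ U₂ μ₂ h)
    {t'' : ℝ}
    (hnear :
      max (max (R₁₁ - μ₁ * n - lo₁₁) (R₁₂ - μ₁ * n - lo₁₂) +
            (U₂ - U₁) *
              (max (A₁₁ - min ((lo₁₂ - lo₁₁) / (U₂ - U₁)) ((lo₂₂ - lo₂₁) / (U₂ - U₁))) 0 *
                max (max ((lo₁₂ - lo₁₁) / (U₂ - U₁)) ((lo₂₂ - lo₂₁) / (U₂ - U₁)) - B₁₂) 0) /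
              (max (A₁₁ - min ((lo₁₂ - lo₁₁) / (U₂ - U₁)) ((lo₂₂ - lo₂₁) / (U₂ - U₁))) 0 +
                max (max ((lo₁₂ - lo₁₁) / (U₂ - U₁)) ((lo₂₂ - lo₂₁) / (U₂ - U₁)) - B₁₂) 0))
          (max (R₂₁ - μ₁ * n - lo₂₁) (R₂₂ - μ₁ * n - lo₂₂) +
            (U₂ - U₁) *
              (max (A₂₁ - min ((lo₁₂ - lo₁₁) / (U₂ - U₁)) ((lo₂₂ - lo₂₁) / (U₂ - U₁))) 0 *
                max (max ((lo₁₂ - lo₁₁) / (U₂ - U₁)) ((lo₂₂ - lo₂₁) / (U₂ - U₁)) - B₂₂) 0) /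
              (max (A₂₁ - min ((lo₁₂ - lo₁₁) / (U₂ - U₁)) ((lo₂₂ - lo₂₁) / (U₂ - U₁))) 0 +
                max (max ((lo₁₂ - lo₁₁) / (U₂ - U₁)) ((lo₂₂ - lo₂₁) / (U₂ - U₁)) - B₂₂) 0)) +
        (s₂ - s₁) *
          (max (max (K₁₁ - (lo₂₁ - lo₁₁) / (s₂ - s₁)) (K₁₂ - (lo₂₂ - lo₁₂) / (s₂ - s₁))) 0 *
            max (max ((lo₂₁ - lo₁₁) / (s₂ - s₁) - J₂₁) ((lo₂₂ - lo₁₂) / (s₂ - s₁) - J₂₂)) 0) /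
          (max (max (K₁₁ - (lo₂₁ - lo₁₁) / (s₂ - s₁)) (K₁₂ - (lo₂₂ - lo₁₂) / (s₂ - s₁))) 0 +
            max (max ((lo₂₁ - lo₁₁) / (s₂ - s₁) - J₂₁) ((lo₂₂ - lo₁₂) / (s₂ - s₁) - J₂₂)) 0) +
        32 / Real.pi ^ 2 * |t''| < h * m₀)
    {t' U μ' : ℝ} (hs₁ : s₁ ≤ t') (hs₂ : t' ≤ s₂) (hU₁ : U₁ ≤ U) (hU₂ : U ≤ U₂) (hμ₁ : μ₁ ≤ μ') (hμ₂ : μ' ≤ μ₂)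
    {σ : InfVolFermionState 2}
    (hmin : σ.IsMeanEnergyMinimiser (hubbardTT'T''SourcedInteraction 1 t' t'' U μ' dWaveFormFactor 0) 2) :
    σ.meanEnergy (pairSourceInteraction dWaveFormFactor) 1 < m₀ := by
  refine (meanEnergy_pairSource_le_nestedBulge_of_rect_mu_cell_of_minimiser hU₁0 hs hUlt hn0 hn2 hh hR₁₁ hR₂₁ hR₁₂
    hR₂₂ h₁₁ h₁₂ h₂₁ h₂₂ hlo₁₁ hlo₂₁ hlo₁₂ hlo₂₂ hs₁ hs₂ hU₁ hU₂ hμ₁ hμ₂ t'' hmin).trans_lt ?_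
  rw [div_lt_iff₀ hh]
  linarith [hnear]

end Uniform

end Literature.MathematicalPhysics.QuantumLattice

end
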